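import Literature.MathematicalPhysics.QuantumFieldTheory.Balaban1983to89.B8Prop3MultiLevelTorusL0
import Literature.MathematicalPhysics.QuantumFieldTheory.Balaban1983to89.B6CubeWindowV1L0
import Literature.MathematicalPhysics.QuantumFieldTheory.Balaban1983to89.B6Geom246MultiLevelBoxL0
import Literature.MathematicalPhysics.QuantumFieldTheory.Balaban1983to89.B6Geom246MultiLevelTorusL0
import Literature.MathematicalPhysics.QuantumFieldTheory.Balaban1983to89.B6GlobalChartV1L0
import Literature.MathematicalPhysics.QuantumFieldTheory.Balaban1983to89.B6MultiLevelBoxOperatorL0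
import Literature.MathematicalPhysics.QuantumFieldTheory.Balaban1983to89.B6MultiLevelTorusOperatorL0
import Literature.MathematicalPhysics.QuantumFieldTheory.Balaban1983to89.B6Prop26KLevelSkeletonV1L0
import Literature.MathematicalPhysics.QuantumFieldTheory.Balaban1983to89.B8Ineq159MultiLevelTorusL0
import Literature.MathematicalPhysics.QuantumFieldTheory.Balaban1983to89.B8Ineq192MultiLevelTorusL0
import Literature.MathematicalPhysics.QuantumFieldTheory.Balaban1983to89.B8Ineq198MultiLevelTorusL0
/-!
# `Balaban1983to89.B8Prop3MultiLevelTorusEtaL0` — LEVEL-0 TWIN (programme G-F3′-L0, director-ym LINE №27 / UV3-NODE §24.5; plan `lit-balaban-r03/G-F3L0-PLAN.md`) of `B8Prop3MultiLevelTorusEta`: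
the same declarations, SAME NAMES AND STATEMENTS, for nested families WITH print's region `Λ₀ = T ∖ Ω₁` ADMITTED (structures
`B6MultiLevelBoxOperatorL0.Domains` / `B6MultiLevelTorusOperatorL0.TDomains`: levels `0, …, k`, the level-`0` block a single site, `Q′₀ = id`,
finite weight `a₀` — print p.225 (2.14) «Σ_{j=0}^k … (Q′₀λ)(x) = λ(x), x ∈ Λ₀», p.229 «taking a sequence (2.1) … smallest possible domains B^j(Λ_j),
and considering the operator Δ_a defined by (2.19), (2.20) for this sequence»).  Every `D`-free object is the lineage's, consumed BY NAME; no existing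
module is touched; no fact is minted.  Sub-row G-F3′-L0∕B8 («N05 cone», ME #33; `lit-balaban-lead/ROW-G-F3p-L0.md` §7): unit `lit-balaban-r05`
(B8 fold owner, r05 gen 76), port discipline of `lit-balaban-r03` (port.py → reduce.py → by-name imports → dedup); referee ref-4.  THE TWIN'S DOCUMENTATION
FOLLOWS VERBATIM (its «levels 1 … k» / «Ω₁ = X» sentences describe the twin; here `j` runs from `0` and `Ω₁` may be a proper subset).

# `Balaban1983to89.B8Prop3MultiLevelTorusEta` — T. Bałaban, *Spaces of regular gauge field configurations on a lattice and gauge fixing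
# conditions*, Commun. Math. Phys. **99** (1985) 75–102 [Balaban1985RegularSpaces], **(1.59) and PROPOSITION 3 pp. 86–87 AT U₀ = 1 ON THE
# `k`-LEVEL V1 TORUS WITH THE LATTICE SPACING `η` EXPLICIT** in print's norms «|A|₍α₎ = sup_j sup_{Ω_j}(Lʲη)^{−α}|A|» and in the [B6] Prop. 2.6
# prefactors «(Lʲη)², Lʲη, 1», **THE CONSTANT `B₀` INDEPENDENT OF `η` AND LINEAR IN THE MAJORANT CONSTANT** (Prop. 3: «B₀ … depend on d and L
# only») — the `η`-consistent reading of the gen-61 files `B8Ineq159MultiLevelTorus` / `B8Prop3MultiLevelTorus` (lattice units `η = 1`), and the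
# SOCKET for r03's ROUTE V entry (2.136)₁ stated in its own letters (`pref c′`, `GlobalBand`)

statement-level skeleton of published theorems with citation tags; proofs where landed; nothing here is a claim about the Yang–Mills mass gap

PDF held: `paper:balaban1985-cmp99-regular-spaces-gauge-fixing` (journal page = PDF page + 74); p. 86 [PDF 12] / p. 87 [PDF 13] re-read this
generation on the text layer (`lit read … --pages 11-14`: p0012.txt «recall the definition: |A|₍α₎ = sup_j sup_{Ω_j}(Lʲη)^{−α}|A|», «hence LʲηQ_jA = B₁,
… |B₁| < 2dLα₁ + C₂α₂²», (1.58), «Theorem 3.3 of [4] implies the bounds … (1.59)», «let us assume that B₀36dα₂ ≦ ½», (1.60), (1.61); p0013.txt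
(1.62), «Proposition 3. … where B₀, B₀(β₀) are the corresponding norms of the operators G(U₀), H(U₀), and depend on d and L only»); [4] = T. Bałaban,
*Propagators for lattice gauge theories in a background field*, CMP **99** (1985) 389–434 [Balaban1985BackgroundPropagators] pp. 397–399 and [B6] =
T. Bałaban, *Propagators and renormalization transformations for lattice gauge theories. II*, CMP **96** (1984) 223–250 [Balaban1984PropagatorsII]
p. 247 (2.136), p. 225 (2.16) through the verbatim quotations of the tree modules `B8Ineq159MultiLevelTorus`, `B6CubeWindowV1`, `B6Prop26KLevelSkeletonV1`.

CITATION HEADER (lean-in-tree rule).  Cell `lit-balaban` (HOME `run/shared/lean/pub/lit-balaban/`), unit `lit-balaban-r05` gen 62 (B8 reader/typer and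
fold owner; B8-CLOSURE.md §5 item 2(iv) follow-up, the «units question» flagged in the gen-61 HANDOFF).  WHAT IS REPRODUCED = SKELETON rows **B8.Eq1.59** /
**B8.Eq1.58** / **B8.Prop3** (cells) as «kernel-checked proofs of a model instance» on p21's V1 multi-level torus calculus read through r03's
`B6GlobalChartV1L0.domT hN D hk` / `blkV1`, now with the lattice spacing `η > 0` a free parameter of the p. 86 norms (`B8ScaledSupNorm.msup (ℓ+1) k η α`)
and of the (2.136)-shape majorants (`C·((Lʲ)·η)^p·e^{−σd_T}`), the constants produced BEFORE `η` and BEFORE the majorant constant `C` and entering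
linearly in `C`.  Theorems only; 0 `def`; every input BY NAME; 0 sorry; D-0026: no `… : Prop` fact.

WHAT IS PRINTED (verbatim).  B8 p. 86 [PDF 12]: *"For the reader's convenience let us recall the definition: |A|₍α₎ = sup_j sup_{Ω_j}(Lʲη)^{−α}|A|. …
hence LʲηQ_jA = B₁, B₁ = B − C_j(LʲηA) on Λ_j, |B₁| < 2dLα₁ + C₂α₂². … A = G(U₀)J + G(U₀)Σ_jQ*_jΛ_j(Lʲη)⁻³B₁, (1.58) … Theorem 3.3 of [4] implies
the bounds: |A|₍₋₁₎, |∇^η_{U₀}A|₍₋₂₎, |D^{η*}_{U₀}D^η_{U₀}A|₍₋₃₎, |Δ^η_{U₀}A|₍₋₃₎ ≦ B₀(|J|₍₋₃₎ + |B₁|) (1.59) … let us assume that B₀36dα₂ ≦ ½. …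
(1.60) Now we assume further that 2α₂² + 20dα₀α₂ + 2C₂α₂² ≦ α₀ + α₁. (1.61)"*; p. 87 [PDF 13]: *"|A| < 5dLB₀(α₀ + α₁)(Lʲη)⁻¹, |∇^η_{U₀}A| <
5dLB₀(α₀ + α₁)(Lʲη)⁻², … on Ω_j. (1.62) … Proposition 3. If U₀, U₁, U₂ satisfy (1.40)–(1.42) with α₀, α₁, α₂ bounded by a constant depending on
d and L only, and α₂ satisfies the additional restriction (1.61), then U₁ satisfies (1.36)–(1.39) with B₁ = 5dLB₀, B₂(β₀) = 5dLB₀(β₀), where B₀,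
B₀(β₀) are the corresponding norms of the operators G(U₀), H(U₀), and depend on d and L only"*.  [4] p. 398: *"Using Lemma 2.1 in [4] we may
replace the factor (Lʲη)^α by (Lʲη)^β(L^{j′}η)^γ with β + γ = α"*.  [B6] (2.136) p. 247: *"|(GJ)(x)|, |(∇GJ)(x)|, |(G∇*J)(x)|, |(ΔGJ)(x)| ≦ O(1)[(Lʲη)²,
Lʲη, Lʲη, 1]e^{−δ₃d(y,y′)}|J| for x ∈ Δ(y), supp J ⊂ Δ(y′)"* (quoted in `B6Prop26KLevelSkeletonV1`); (2.16) p. 225 the weights `a_j` of `Δ_a`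
(quoted in `B6CubeWindowV1.GlobalBand`).

WHY THIS FILE (the units question of the gen-61 HANDOFF, settled).  The gen-61 files fix `η = 1` in `msup` and in the majorant prefactors `(Lʲ)^p`,
and produce `B₀ = B₀(d, ℓ, C, σ, n)` AFTER the majorant constant `C` (non-linearly: `C·Lⁿ·K + 1`).  r03's genuine `G(1) = B6SectAVectorModelV1.GE
(domT hN D hk) hc′ hw` lives in the units of the V1 factor `c′` (= `η⁻¹`): its (2.136)₁ majorant (`B6CubeWindowV1L0.prop26_2136_kLevel_cubes_band`)
has the prefactor `B6Prop26KLevelSkeletonV1L0.pref c′ y = ((Lʲ)/c′)² = ((Lʲ)·η)²`, and print's (2.16) weight band `GlobalBand b₀ b₁ c′ w` reads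
`w ≦ b₁(Lʲ)^{d+1}((Lʲ)·η)⁻²`, i.e. the gen-61 window constant would be `a₁ = b₁c′²`: fed as they stand, the gen-61 theorems give `B₀′ = B₀(1 + 2b₁c′²)`,
NOT uniform in the lattice spacing.  Here every weight carries `η`: `|X|₍₋ₙ₎` with `(Lʲη)ⁿ`, the majorants with `((Lʲ)η)^p`, the window with
`((Lʲ)η)⁻²`, (1.56) with `((Lʲ)η)⁻¹` — and then, by homogeneity, ALL constants are `η`-free («depend on d and L only» — and on the decay rate `σ`
and the weight exponent; linear in `C`).  The gen-61 theorems follow from §§1–6 at `η = 1` (they are imported, not re-proved: §1 is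
re-derived from the public engine pieces `B8Ineq159MultiLevelTorusL0.apply_le_of_invPow_blk` + `B8Ineq198MultiLevelTorusL0.rowSum_and_thresholdT`
in `C`-linear form, §4 from `B8Prop3MultiLevelTorusL0.abs_QsE_aE_le` by rescaling).

WHAT THIS FILE PROVES (theorems only).
* §1 **`sup347_linear`** — [4] (3.47) AT U = 1 ⇐ A (2.136)-SHAPE MAJORANT, `C`-LINEAR: there are `B₀ ≥ 1`, `N₁ ≥ 1` (functions of `d, ℓ, σ, n` ONLY)
  such that for every admissible torus datum, every prefactor exponent `p`, carrier `X`, block map, operator `T`, EVERY `C ≥ 0` with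
  `HasMajorant … T (C(Lʲ)^p e^{−σd_T})` and every `|u(z)| ≦ S(L^{j(z)})⁻ⁿ`: `|(Tu)(x)| ≦ B₀·C·(Lʲ)^p(Lʲ)⁻ⁿS`; **`sup347_eta`** — the same with the
  spacing `η > 0`: majorant `C((Lʲ)η)^p e^{−σd_T}`, input `|u(z)| ≦ S((L^{j(z)})η)⁻ⁿ`, output `|(Tu)(x)| ≦ B₀·C·((Lʲ)η)^p((Lʲ)η)⁻ⁿS`, SAME `B₀`.
* §2 **`ineq159_multiLevelTorus_V1_eta`** / **`_three_eta`** — (1.59), the three propagator members in operator form on the V1 torus with `η`: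
  majorants `C((Lʲ)η)²e^{−σd_T}` (`Gv`), `C(Lʲ)ηe^{−σd_T}` (`DGv ν`), `Ce^{−σd_T}` (`LGv`), input `|X(b)| ≦ S((L^{j(b)})η)⁻ⁿ` ⟹
  `|(Gv X)(b)| ≦ B₀C((Lʲ)η)²((Lʲ)η)⁻ⁿS`, `|(DGv ν X)(b)| ≦ B₀C(Lʲ)η((Lʲ)η)⁻ⁿS`, `|(LGv X)(b)| ≦ B₀C((Lʲ)η)⁻ⁿS`.
* §3 the `msup`-`η` dictionary on a finite carrier (`bdd_blk_eta`, `pointwise_of_msup_le_blk_eta`, `msup_le_of_pointwise_blk_eta`) and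
  **`ineq159_multiLevelTorus_V1_msup_eta`**: «|Gv X|₍₋₁₎ ≦ B₀C|X|₍₋₃₎, |DGv ν X|₍₋₂₎ ≦ B₀C|X|₍₋₃₎, |LGv X|₍₋₃₎ ≦ B₀C|X|₍₋₃₎» in
  `msup (ℓ+1) k η (−1∕−2∕−3)` — print's (1.59) symbol for symbol, `B₀` independent of `η`.
* §4 **`abs_QsE_aE_le_eta`** — THE SIZE OF (1.58)'s SECOND SUMMAND in `η`-units: weights `|w_{(j,c)}| ≦ a₁(Lʲ)^{d+1}((Lʲ)η)⁻²` («a_j = (Lʲη)⁻²»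
  times the block volume), data `|B_{(j,c)}| ≦ β((Lʲ)η)⁻¹` ((1.56) «LʲηQ_jA = B₁, |B₁| ≦ β») ⟹ `|(Q*aB)(b)| ≦ 2a₁β((L^{j(b)})η)⁻³`
  («|Σ_jQ*_jΛ_j(Lʲη)⁻³B₁|₍₋₃₎ ≦ 2a₁|B₁|»); **`window_of_globalBand`** — r03's `GlobalBand b₀ b₁ c′ w` (`b₀ ≥ 0`) IS this window with `a₁ := b₁`,
  `η := |c′|⁻¹`; **`pref_eq`** — r03's prefactor `pref c′ y = ((Lʲ)·|c′|⁻¹)²`.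
* §5 **`ineq159_A_member_printed_V1_eta`** — (1.59) IN PRINT'S SHAPE «|A|₍₋₁₎ ≦ B₀′(|J|₍₋₃₎ + |B₁|)» for the `|A|₍₋₁₎` member of THE genuine
  `k`-level `G(1) = GE (domT hN D hk) hc′ hw`, modulo its (2.136)₁ majorant `C((Lʲ)η)²e^{−σd_T}`: `|A(b)| ≦ B₀C(1 + 2a₁)(n_J + β)((L^{j(b)})η)⁻¹`.
* §6 **`prop3_multiLevelTorus_V1_eta`** — PROPOSITION 3 AT U₀ = 1 ON THE `k`-LEVEL V1 TORUS, `η` EXPLICIT, modulo the three (2.136) majorants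
  (`∇^η`, `Δ^η` at `U₀ = 1` kept as arbitrary linear maps `Dop ν`, `Lop`, as in `B8.apriori_160`): (1.55) `∂*∂A = J`, (1.42) `R∂*A = 0`, (1.56)
  `QA = B`, `|J|₍₋₃₎ ≦ n_J`, `|B₁| ≦ n_B`, the size lines (1.55)/(1.56), «B₀′36dα₂ ≦ ½», `50dα₂ ≦ 1`, (1.61) ⟹ **`|A|₍₋₁₎, |∇A|₍₋₂₎, |D*DA|₍₋₃₎,
  |ΔA|₍₋₃₎ ≦ 5dLB₀′(α₀ + α₁)`** in `msup (ℓ+1) k η ·` AND pointwise «on Ω_j» with `((Lʲ)η)⁻¹`, `((Lʲ)η)⁻²`, `((Lʲ)η)⁻³`; `B₀′ = (B₀C + 1)(1 + 2a₁)`,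
  `B₀ = B₀(d, ℓ, σ)` — INDEPENDENT OF `η`.
* §7 THE ROUTE V SOCKET in r03's letters: **`ineq159_A_member_pref`** and **`prop3_multiLevelTorus_V1_pref`** — §5/§6 with `η := |c′|⁻¹`, slot 1
  hypothesis LITERALLY `HasMajorant (geomT D) (blkV1 hN D) (onFun (GE (domT hN D hk) hc′ hw)) (fun y y′ ↦ C · pref c′ y · e^{−σd_T(y,y′)})`
  (the conclusion shape of `B6CubeWindowV1L0.prop26_2136_kLevel_cubes_band`, any `C ≥ 0`, `σ > 0`) and the window replaced by
  `GlobalBand b₀ b₁ c′ w` (`a₁ := b₁`).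

HONEST SCOPE / NOT CLAIMED.  (i) `Ω₁ = T_η`, levels `1 … k`, level of a bond = level of its initial point (r03's `blkV1`); `η > 0` is a free
parameter of the NORMS and of the majorant/window/data SHAPES — the identification `η = |c′|⁻¹` with the V1 factor of `GE` is made only in §7, and
whether r03's members are normalised so that their (2.136) constants are `c′`-free is the B6 side's matter (this file is correct for every `C ≥ 0`).
(ii) The constant `2` of §4 uses `L ≥ 2`; print's `O(1)` sits in `B₀`; `B₀′ = (B₀C + 1)(1 + 2a₁)` (the `+1` makes the trivial member `|D*DA|₍₋₃₎ =
|J|₍₋₃₎ ≦ B₀′(…)` honest for small `C`).  (iii) §§5–7 are CONDITIONAL on the (2.136)-shape majorants, taken as ARGUMENTS: (2.136)₁ for the genuine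
`G(1)` is r03's ROUTE V (`prop26_2136_kLevel_cubes_band`, p354047, itself modulo the (2.134) data of the (2.91)-family — p38/p22/r03 lanes);
(2.136)₂,₄ (`∇G(1)`, `ΔG(1)`) are not begun on the B6 side and `∇^η`, `Δ^η` at `U₀ = 1` are NOT instantiated here (arbitrary `Dop`, `Lop`).
(iv) Print's `d`, `L` in `5dLB₀` enter as reals `d_P ≥ 0`, `L_P`, `d_PL_P ≥ 1`; the size lines (1.55)/(1.56)/(1.61)/«B₀′36dα₂ ≦ ½» are
HYPOTHESES on numbers (their derivation (1.49)–(1.56) from (1.40)–(1.42) is p40's ℤᵈ `B8Prop3Concrete` matter, not re-done on V1).  (v) The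
`σ > 0` of the majorant must be supplied by the producer (for ROUTE V: `delta3 α (2δ/(d+1)) > 0`, i.e. a Lemma-2.1 budget `α < 1`).  (vi) Rows
B8.Eq1.58 / B8.Eq1.59 / B8.Prop3 cells only; no head moves (G.5-45); the general-background statements (row B9.Thm3.3, `B9.Thm33Printed`) are
NOT touched.  NOT summit progress, NOT continuum, NOT Clay.

RELATED IN THE TREE, NOT DUPLICATED (stem check 2026-08-23T06:22Z: `ls Balaban1983to89 | grep -i '^B8Prop3\|^B8Ineq159'` = `B8Ineq159FlatTorus`,
`B8Ineq159MultiLevelTorus`, `B8Prop3Concrete`, `B8Prop3Holder`, `B8Prop3MultiLevelTorus` — none `η`-general; `lean search 'sup347|msup (ℓ + 1) k η'`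
= the `η = 1` forms only): `B8Ineq159MultiLevelTorus.{apply_le_of_invPow_blk, eq158_line2_V1, len_blkV1}`, `B8Ineq198MultiLevelTorusL0.rowSum_and_thresholdT`,
`B8Prop3MultiLevelTorusL0.abs_QsE_aE_le`, `B8.apriori_160` / `B8.apriori_162`, `B8ScaledSupNorm.*`, `B6RandomWalk.{HasMajorant, hasMajorant_mono}`,
`B6CubeWindowV1.GlobalBand`, `B6Prop26KLevelSkeletonV1L0.pref`, `B6GlobalChartV1.{PV, domT, blkV1}`, `B6SectAVectorModelV1.GE` (USED BY NAME).
-/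

namespace Literature.MathematicalPhysics.QuantumFieldTheory.Balaban1983to89.B8Prop3MultiLevelTorusEtaL0

open Finset
open B4Reflection242 (boxDom)
open B6MultiLevelBoxOperator hiding Domains mlOp_apply
open B6MultiLevelBoxOperatorL0
open B6MultiLevelTorusOperator hiding TDomains mlOpT_apply mlOpT_eq_reindex_chart mlOpT_mul_reindex mlOpT_tshift
open B6MultiLevelTorusOperatorL0
open B6Geom246MultiLevelBox hiding Touch blkOf blkOf_corner blkOf_eq_iff_blk blkOf_eq_of_blk_i_eq blkOf_val bond bond_adj bset cen connected coord_bounds corner corner_mem csys dist_blkOf_le_box dist_blkOf_le_coord dist_blkOf_le_line dist_cen_le_of_adj dist_cen_le_of_touch dist_le_one_of_near dist_toR_cen_le exists_blkOf_eq geom lemma21_box lev_corner lev_eq_of_blkOf_eq levelGap pack reachable_blkOf reachable_of_near realizes scale_bounds touch_symm triangle_refl_nonneg walk_disp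
open B6Geom246MultiLevelBoxL0
open B6Geom246MultiLevelTorus hiding TouchT blkHom blkMap blkMap_blkOf blkMap_injective blkMap_surjective blkOf_tshift_eq bondT bondT_adj bond_le_bondT connectedT csysT distT_le_dist_box distT_le_dist_chart dist_posT_le_of_adj dist_posT_le_of_touchT dist_site_posT_le geomT label_bounds lemma21_torus levelGapT packT posT realizesT touchT_symm triangle_refl_nonneg_T walk_dispT
open B6Geom246MultiLevelTorusL0
open B6RandomWalk (HasMajorant BlockSupp hasMajorant_mono)
open B6Ineq261LevelGap (K261 K261_nonneg)
open B8Ineq192MultiLevelTorusL0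
open B8Ineq198MultiLevelTorusL0 (rowSum_and_thresholdT)
open B8Ineq159MultiLevelTorus (eq158_line2_V1)
open B8Ineq159MultiLevelTorusL0 (apply_le_of_invPow_blk len_blkV1)
open B8Prop3MultiLevelTorusL0 (abs_QsE_aE_le)
open B6GlobalChartV1 (PV toBox)
open B6GlobalChartV1L0 (blkV1 domT)
open B6SectAOperatorsV1 (dE dsE dcE dcsE QE QsE aE RE BondIdx BondIdxSpace)
open B6SectAVectorModelV1 (GE)
open BalabanImbrieJaffe1984to88.BIJ85AxialPropagator411 (BondSpace)
open B6Ineq2133TwoScaleV1 (onFun onFun_apply)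
open B6CubeWindowV1 (GlobalBand)
open B6Prop26KLevelSkeletonV1L0 (pref)
open B8ScaledSupNorm (msup weight Bdd msup_le_of_pointwise norm_le_of_msup_le msup_nonneg)

noncomputable section

variable {d : ℕ}

/-- the cast of the block side `L = ℓ + 1`. [folklore] -/
private theorem castL (ℓ : ℕ) : (((ℓ + 1 : ℕ) : ℝ)) = (ℓ : ℝ) + 1 := by push_cast; ring

/-! ## §1  The [4] (3.47) / Lemma-2.1 engine in `C`-linear form, and with the lattice spacing `η` -/

section Engine

/-- **[4] (3.47) AT U = 1 ⇐ A (2.136)-SHAPE MAJORANT, `C`-LINEAR FORM** ([4] p. 398 «Using Lemma 2.1 … we may replace the factor (Lʲη)^α by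
(Lʲη)^β(L^{j′}η)^γ»; B8 Prop. 3 «B₀ … depend on d and L only»): for every decay rate `σ > 0` and weight exponent `n` there are `B₀ ≥ 1`, `N₁ ≥ 1`,
FUNCTIONS OF `d, ℓ, σ, n` ONLY, such that for every `k`, `M_h ≥ 1`, `R·L·M_h ≥ N₁ + 1`, torus size `P`, nested torus family `D`, prefactor exponent
`p`, carrier `X` with block map `blk`, operator `T` and EVERY CONSTANT `C ≥ 0` with «|(Tμ)(x)| ≦ C(Lʲ)^p e^{−σd(y,y′)}|μ|, x ∈ Δ(y), supp μ ⊂ Δ(y′)»,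
and every `u` with `|u(z)| ≦ S(L^{j(z)})⁻ⁿ`: `|(Tu)(x)| ≦ B₀·C·(L^{j(x)})^p(L^{j(x)})⁻ⁿS` — the constant of `B8Ineq159MultiLevelTorusL0.sup347_of_majorant`
made linear in `C` and produced before it (lattice units).
[cite: Balaban1985BackgroundPropagators, (3.47) p.398, Theorem 3.3 p.399, (3.41) p.397; Balaban1985RegularSpaces, (1.59) p.86, Prop. 3 p.87; Balaban1984PropagatorsII, Prop. 2.6 (2.136) p.247, Lemma 2.1 (2.60)–(2.61) p.234, (2.52)–(2.55) p.232] -/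
theorem sup347_linear (d ℓ : ℕ) {σ : ℝ} (hσ : 0 < σ) (n : ℕ) :
    ∃ B₀ : ℝ, ∃ N₁ : ℕ, 1 ≤ B₀ ∧ 0 < N₁ ∧
      ∀ (k Mh R : ℕ), 1 ≤ Mh → N₁ + 1 ≤ R * ((ℓ + 1) * Mh) →
      ∀ (P : Fin (d + 1) → ℕ) (_hP : ∀ μ, 1 ≤ P μ) (D : B6MultiLevelTorusOperatorL0.TDomains d ℓ Mh k P R) (p : ℕ)
        (X : Type) (blk : X → ↥(bset D.toDomains)) (T : Module.End ℝ (X → ℝ)) (C : ℝ), 0 ≤ C →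
        HasMajorant (g := geomT D) blk T
          (fun y y' => C * (geomT D).len y ^ p * Real.exp (-(σ * (geomT D).dist y y'))) →
        ∀ (u : X → ℝ) (S : ℝ), 0 ≤ S → (∀ z, |u z| ≤ S * ((geomT D).len (blk z) ^ n)⁻¹) →
          ∀ x : X, |T u x| ≤ B₀ * C * (geomT D).len (blk x) ^ p * ((geomT D).len (blk x) ^ n)⁻¹ * S := by
  have hL0 : (0 : ℝ) < (ℓ : ℝ) + 1 := by positivity
  -- Lemma 2.1 / absorption at the rate `σ/2` (majorant rate `σ = σ/2 + σ/2`)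
  obtain ⟨τ, hτ⟩ : ∃ τ : ℝ, τ = σ / 2 := ⟨_, rfl⟩
  have hτ0 : 0 < τ := by rw [hτ]; positivity
  obtain ⟨N₁, hN₁⟩ : ∃ N₁ : ℕ, N₁ = ⌈(2 * ((d : ℝ) + 1) + n + 1) * ((ℓ : ℝ) + 1) / τ⌉₊ + 1 := ⟨_, rfl⟩
  have hN₁pos : 0 < N₁ := by rw [hN₁]; omega
  obtain ⟨cK, hcK⟩ : ∃ cK : ℝ, cK = K261 N₁ (d + 1) ((ℓ : ℝ) + 1) 1 (1 * τ) := ⟨_, rfl⟩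
  have hcK0 : 0 ≤ cK := by rw [hcK]; exact K261_nonneg hL0.le zero_le_one
  have hB0 : 0 ≤ ((ℓ : ℝ) + 1) ^ n * cK := mul_nonneg (pow_nonneg hL0.le n) hcK0
  refine ⟨((ℓ : ℝ) + 1) ^ n * cK + 1, N₁, by linarith, hN₁pos, ?_⟩
  intro k Mh R hMh1 hRM1 P hP D p X blk T C hC hT u S hS hu x
  have hRMone : 1 ≤ R * ((ℓ + 1) * Mh) := le_trans (by omega) hRM1
  obtain ⟨hrow, hthr⟩ := rowSum_and_thresholdT (D := D) hMh1 hP hτ0 n hN₁ hRM1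
  rw [← hcK] at hrow
  have hlen0 : ∀ y : ↥(bset D.toDomains), 0 ≤ (geomT D).len y := fun y => (lenT_pos D y).le
  have hrate : τ + τ ≤ σ := by rw [hτ]; linarith
  have h := apply_le_of_invPow_blk (D := D) hMh1 hP hRMone blk (σ := σ) (β := τ) (τ := τ) (c := cK) hC hτ0.le
    hrate (pf := fun y => (geomT D).len y ^ p) (fun y => pow_nonneg (hlen0 y) p) hT (hrow τ le_rfl) n hthr hS hu x
  refine h.trans ?_
  show S * C * (geomT D).len (blk x) ^ p * (((ℓ : ℝ) + 1) ^ n * cK) * ((geomT D).len (blk x) ^ n)⁻¹ ≤ _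
  have hq : 0 ≤ C * ((geomT D).len (blk x) ^ p * (((geomT D).len (blk x) ^ n)⁻¹ * S)) :=
    mul_nonneg hC (mul_nonneg (pow_nonneg (hlen0 _) p) (mul_nonneg (inv_nonneg.2 (pow_nonneg (hlen0 _) n)) hS))
  have heq : S * C * (geomT D).len (blk x) ^ p * (((ℓ : ℝ) + 1) ^ n * cK) * ((geomT D).len (blk x) ^ n)⁻¹ =
      (((ℓ : ℝ) + 1) ^ n * cK) * (C * ((geomT D).len (blk x) ^ p * (((geomT D).len (blk x) ^ n)⁻¹ * S))) := by ring
  rw [heq]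
  calc (((ℓ : ℝ) + 1) ^ n * cK) * (C * ((geomT D).len (blk x) ^ p * (((geomT D).len (blk x) ^ n)⁻¹ * S)))
      ≤ (((ℓ : ℝ) + 1) ^ n * cK + 1) * (C * ((geomT D).len (blk x) ^ p * (((geomT D).len (blk x) ^ n)⁻¹ * S))) :=
        mul_le_mul_of_nonneg_right (by linarith) hq
    _ = (((ℓ : ℝ) + 1) ^ n * cK + 1) * C * (geomT D).len (blk x) ^ p * ((geomT D).len (blk x) ^ n)⁻¹ * S := by ring

/-- **[4] (3.47) AT U = 1 WITH THE LATTICE SPACING `η`** (print's norms «|A|₍α₎ = sup_j sup_{Ω_j}(Lʲη)^{−α}|A|» and prefactors «(Lʲη)^p»): the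
SAME `B₀ ≥ 1`, `N₁` as `sup347_linear` (functions of `d, ℓ, σ, n` only — «depend on d and L only», INDEPENDENT OF `η`) serve every spacing
`η > 0`: a majorant `C((Lʲ)η)^p e^{−σd_T}` (`C ≥ 0`) and an input `|u(z)| ≦ S((L^{j(z)})η)⁻ⁿ` give `|(Tu)(x)| ≦ B₀·C·((Lʲ)η)^p((Lʲ)η)⁻ⁿS`.  By
homogeneity from `sup347_linear` (`C ↦ Cη^p`, `S ↦ Sη⁻ⁿ`).
[cite: Balaban1985BackgroundPropagators, (3.47) p.398, (3.41) p.397, Theorem 3.3 p.399; Balaban1985RegularSpaces, (1.59) p.86, p.86 (definition after (1.55)), Prop. 3 p.87; Balaban1984PropagatorsII, Prop. 2.6 (2.136) p.247, Lemma 2.1 (2.60)–(2.61) p.234] -/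
theorem sup347_eta (d ℓ : ℕ) {σ : ℝ} (hσ : 0 < σ) (n : ℕ) :
    ∃ B₀ : ℝ, ∃ N₁ : ℕ, 1 ≤ B₀ ∧ 0 < N₁ ∧
      ∀ (k Mh R : ℕ), 1 ≤ Mh → N₁ + 1 ≤ R * ((ℓ + 1) * Mh) →
      ∀ (P : Fin (d + 1) → ℕ) (_hP : ∀ μ, 1 ≤ P μ) (D : B6MultiLevelTorusOperatorL0.TDomains d ℓ Mh k P R) (η : ℝ), 0 < η → ∀ (p : ℕ)
        (X : Type) (blk : X → ↥(bset D.toDomains)) (T : Module.End ℝ (X → ℝ)) (C : ℝ), 0 ≤ C →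
        HasMajorant (g := geomT D) blk T
          (fun y y' => C * ((geomT D).len y * η) ^ p * Real.exp (-(σ * (geomT D).dist y y'))) →
        ∀ (u : X → ℝ) (S : ℝ), 0 ≤ S → (∀ z, |u z| ≤ S * (((geomT D).len (blk z) * η) ^ n)⁻¹) →
          ∀ x : X, |T u x| ≤ B₀ * C * ((geomT D).len (blk x) * η) ^ p * (((geomT D).len (blk x) * η) ^ n)⁻¹ * S := by
  obtain ⟨B₀, N₁, hB₀, hN₁, h⟩ := sup347_linear d ℓ hσ n
  refine ⟨B₀, N₁, hB₀, hN₁, ?_⟩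
  intro k Mh R hMh1 hRM1 P hP D η hη p X blk T C hC hT u S hS hu x
  have hηp : 0 ≤ η ^ p := pow_nonneg hη.le p
  have hηn : 0 < η ^ n := pow_pos hη n
  -- the majorant with the constant `Cη^p` in lattice units
  have hT' : HasMajorant (g := geomT D) blk T
      (fun y y' => (C * η ^ p) * (geomT D).len y ^ p * Real.exp (-(σ * (geomT D).dist y y'))) :=
    hasMajorant_mono (g := geomT D) blk hT fun y y' => le_of_eq (by rw [mul_pow]; ring)
  -- the input with the constant `S(ηⁿ)⁻¹` in lattice units
  have hu' : ∀ z, |u z| ≤ S * (η ^ n)⁻¹ * ((geomT D).len (blk z) ^ n)⁻¹ := fun z => by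
    refine (hu z).trans (le_of_eq ?_)
    rw [mul_pow, mul_inv]
    ring
  have key := h k Mh R hMh1 hRM1 P hP D p X blk T (C * η ^ p) (mul_nonneg hC hηp) hT' u (S * (η ^ n)⁻¹)
    (mul_nonneg hS (inv_nonneg.2 hηn.le)) hu' x
  refine key.trans (le_of_eq ?_)
  simp only [mul_pow, mul_inv]
  ring

end Engine

/-! ## §2  (1.59), the three propagator members in operator form, at U₀ = 1 on the `k`-level V1 torus, with `η` -/

section V1

/-- **(1.59) AT U₀ = 1 ON THE `k`-LEVEL TORUS, VECTOR SIDE, WITH THE LATTICE SPACING `η` — THE THREE PROPAGATOR MEMBERS IN OPERATOR FORM, THE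
PROP.-2.6 MAJORANTS AS ARGUMENTS, `B₀` BEFORE `η` AND BEFORE THE MAJORANT CONSTANT** («Theorem 3.3 of [4] implies the bounds |A|₍₋₁₎, |∇^η_{U₀}A|₍₋₂₎,
…, |Δ^η_{U₀}A|₍₋₃₎ ≦ B₀(|J|₍₋₃₎ + |B₁|)», «B₀ … depend on d and L only»): for every `σ > 0` and `n` there are `B₀ ≥ 1`, `N₁ ≥ 1` (functions of
`d, ℓ, σ, n`) such that for every `k`, `M_h ≥ 1`, `R·L·M_h ≥ N₁ + 1`, `P′_μ ≥ 1`, torus family `D`, V1 volume (`m, K`, `hN`), EVERY `η > 0`, EVERY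
`C ≥ 0` and operators `Gv`, `DGv ν`, `LGv` on the fine vector fields with the (2.136) majorants «O(1)[(Lʲη)², Lʲη, 1]e^{−δ₃d(y,y′)}» (`O(1) = C`,
`δ₃ = σ`) on `blkV1 hN D`, and every vector field `X` with `|X(b)| ≦ S((L^{j(b)})η)⁻ⁿ`: at every bond `b` of level `j`,
`|(Gv X)(b)| ≦ B₀C((Lʲ)η)²((Lʲ)η)⁻ⁿS`, `|(DGv ν X)(b)| ≦ B₀C(Lʲ)η((Lʲ)η)⁻ⁿS`, `|(LGv X)(b)| ≦ B₀C((Lʲ)η)⁻ⁿS`.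
[cite: Balaban1985RegularSpaces, (1.59) p.86, (1.58) p.86, Prop. 3 p.87; Balaban1985BackgroundPropagators, Theorem 3.3 p.399, (3.47) p.398; Balaban1984PropagatorsII, Prop. 2.6 (2.136) p.247, (2.19) p.226, Lemma 2.1 (2.60)–(2.61) p.234] -/
theorem ineq159_multiLevelTorus_V1_eta (d ℓ : ℕ) {σ : ℝ} (hσ : 0 < σ) (n : ℕ) :
    ∃ B₀ : ℝ, ∃ N₁ : ℕ, 1 ≤ B₀ ∧ 0 < N₁ ∧
      ∀ (k Mh R : ℕ), 1 ≤ Mh → N₁ + 1 ≤ R * ((ℓ + 1) * Mh) →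
      ∀ (P' : Fin (d + 1) → ℕ) (_hP : ∀ μ, 1 ≤ P' μ) (D : B6MultiLevelTorusOperatorL0.TDomains d ℓ Mh k P' R)
        (m K : ℕ) (hd : 1 ≤ d + 1) (hL : Odd (ℓ + 1) ∧ 1 < ℓ + 1)
        (hN : ∀ μ, N0 ℓ Mh k P' μ = (PV d ℓ m K hd hL).sitesPerDir 0) (η : ℝ), 0 < η → ∀ (C : ℝ), 0 ≤ C →
        ∀ (Gv LGv : Module.End ℝ (PBond (PV d ℓ m K hd hL) 0 → ℝ))
        (DGv : Fin (d + 1) → Module.End ℝ (PBond (PV d ℓ m K hd hL) 0 → ℝ)),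
        HasMajorant (g := geomT D) (blkV1 hN D) Gv
          (fun y y' => C * ((geomT D).len y * η) ^ 2 * Real.exp (-(σ * (geomT D).dist y y'))) →
        (∀ ν, HasMajorant (g := geomT D) (blkV1 hN D) (DGv ν)
          (fun y y' => C * ((geomT D).len y * η) * Real.exp (-(σ * (geomT D).dist y y')))) →
        HasMajorant (g := geomT D) (blkV1 hN D) LGv
          (fun y y' => C * Real.exp (-(σ * (geomT D).dist y y'))) →
        ∀ (Xv : PBond (PV d ℓ m K hd hL) 0 → ℝ) (S : ℝ), 0 ≤ S →
          (∀ b, |Xv b| ≤ S * (((geomT D).len (blkV1 hN D b) * η) ^ n)⁻¹) →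
          ∀ b : PBond (PV d ℓ m K hd hL) 0,
            |Gv Xv b| ≤ B₀ * C * ((geomT D).len (blkV1 hN D b) * η) ^ 2 * (((geomT D).len (blkV1 hN D b) * η) ^ n)⁻¹ * S ∧
            (∀ ν, |DGv ν Xv b| ≤
              B₀ * C * ((geomT D).len (blkV1 hN D b) * η) * (((geomT D).len (blkV1 hN D b) * η) ^ n)⁻¹ * S) ∧
            |LGv Xv b| ≤ B₀ * C * (((geomT D).len (blkV1 hN D b) * η) ^ n)⁻¹ * S := by
  obtain ⟨B₀, N₁, hB₀, hN₁, h⟩ := sup347_eta d ℓ hσ n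
  refine ⟨B₀, N₁, hB₀, hN₁, ?_⟩
  intro k Mh R hMh1 hRM1 P' hP D m K hd hL hN η hη C hC Gv LGv DGv hG hD hLap Xv S hS hX b
  have key := h k Mh R hMh1 hRM1 P' hP D η hη
  refine ⟨?_, fun ν => ?_, ?_⟩
  · exact key 2 _ (blkV1 hN D) Gv C hC hG Xv S hS hX b
  · have hD' : HasMajorant (g := geomT D) (blkV1 hN D) (DGv ν)
        (fun y y' => C * ((geomT D).len y * η) ^ 1 * Real.exp (-(σ * (geomT D).dist y y'))) :=
      hasMajorant_mono (g := geomT D) (blkV1 hN D) (hD ν) fun y y' => le_of_eq (by rw [pow_one])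
    have h1 := key 1 _ (blkV1 hN D) (DGv ν) C hC hD' Xv S hS hX b
    rw [pow_one] at h1
    exact h1
  · have hL' : HasMajorant (g := geomT D) (blkV1 hN D) LGv
        (fun y y' => C * ((geomT D).len y * η) ^ 0 * Real.exp (-(σ * (geomT D).dist y y'))) :=
      hasMajorant_mono (g := geomT D) (blkV1 hN D) hLap fun y y' => le_of_eq (by rw [pow_zero, mul_one])
    have h0 := key 0 _ (blkV1 hN D) LGv C hC hL' Xv S hS hX b
    rw [pow_zero, mul_one] at h0
    exact h0

/-- **(1.59) WITH THE PRINTED EXPONENTS (`n = 3`) AND THE SPACING `η`: «|G(U₀)X|₍₋₁₎, |∇_{U₀}G(U₀)X|₍₋₂₎, |Δ_{U₀}G(U₀)X|₍₋₃₎ ≦ B₀|X|₍₋₃₎»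
AT U₀ = 1 ON THE `k`-LEVEL V1 TORUS**, pointwise: under the hypotheses of `ineq159_multiLevelTorus_V1_eta` with `n = 3`, for
`|X(b)| ≦ S((L^{j(b)})η)⁻³`: `|(Gv X)(b)| ≦ B₀CS((Lʲ)η)⁻¹`, `|(DGv ν X)(b)| ≦ B₀CS((Lʲ)η)⁻²`, `|(LGv X)(b)| ≦ B₀CS((Lʲ)η)⁻³`.
[cite: Balaban1985RegularSpaces, (1.59) p.86, (1.62) p.87; Balaban1985BackgroundPropagators, (3.47) p.398 (γ = −3), Theorem 3.3 p.399; Balaban1984PropagatorsII, Prop. 2.6 (2.136) p.247] -/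
theorem ineq159_multiLevelTorus_V1_three_eta (d ℓ : ℕ) {σ : ℝ} (hσ : 0 < σ) :
    ∃ B₀ : ℝ, ∃ N₁ : ℕ, 1 ≤ B₀ ∧ 0 < N₁ ∧
      ∀ (k Mh R : ℕ), 1 ≤ Mh → N₁ + 1 ≤ R * ((ℓ + 1) * Mh) →
      ∀ (P' : Fin (d + 1) → ℕ) (_hP : ∀ μ, 1 ≤ P' μ) (D : B6MultiLevelTorusOperatorL0.TDomains d ℓ Mh k P' R)
        (m K : ℕ) (hd : 1 ≤ d + 1) (hL : Odd (ℓ + 1) ∧ 1 < ℓ + 1)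
        (hN : ∀ μ, N0 ℓ Mh k P' μ = (PV d ℓ m K hd hL).sitesPerDir 0) (η : ℝ), 0 < η → ∀ (C : ℝ), 0 ≤ C →
        ∀ (Gv LGv : Module.End ℝ (PBond (PV d ℓ m K hd hL) 0 → ℝ))
        (DGv : Fin (d + 1) → Module.End ℝ (PBond (PV d ℓ m K hd hL) 0 → ℝ)),
        HasMajorant (g := geomT D) (blkV1 hN D) Gv
          (fun y y' => C * ((geomT D).len y * η) ^ 2 * Real.exp (-(σ * (geomT D).dist y y'))) →
        (∀ ν, HasMajorant (g := geomT D) (blkV1 hN D) (DGv ν)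
          (fun y y' => C * ((geomT D).len y * η) * Real.exp (-(σ * (geomT D).dist y y')))) →
        HasMajorant (g := geomT D) (blkV1 hN D) LGv
          (fun y y' => C * Real.exp (-(σ * (geomT D).dist y y'))) →
        ∀ (Xv : PBond (PV d ℓ m K hd hL) 0 → ℝ) (S : ℝ), 0 ≤ S →
          (∀ b, |Xv b| ≤ S * (((geomT D).len (blkV1 hN D b) * η) ^ 3)⁻¹) →
          ∀ b : PBond (PV d ℓ m K hd hL) 0,
            |Gv Xv b| ≤ B₀ * C * S * ((geomT D).len (blkV1 hN D b) * η)⁻¹ ∧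
            (∀ ν, |DGv ν Xv b| ≤ B₀ * C * S * (((geomT D).len (blkV1 hN D b) * η) ^ 2)⁻¹) ∧
            |LGv Xv b| ≤ B₀ * C * S * (((geomT D).len (blkV1 hN D b) * η) ^ 3)⁻¹ := by
  obtain ⟨B₀, N₁, hB₀, hN₁, h⟩ := ineq159_multiLevelTorus_V1_eta d ℓ hσ 3
  refine ⟨B₀, N₁, hB₀, hN₁, ?_⟩
  intro k Mh R hMh1 hRM1 P' hP D m K hd hL hN η hη C hC Gv LGv DGv hG hD hLap Xv S hS hX b
  obtain ⟨h2, h1, h0⟩ := h k Mh R hMh1 hRM1 P' hP D m K hd hL hN η hη C hC Gv LGv DGv hG hD hLap Xv S hS hX b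
  have hm : 0 < (geomT D).len (blkV1 hN D b) * η := mul_pos (lenT_pos D _) hη
  have hm0 : (geomT D).len (blkV1 hN D b) * η ≠ 0 := hm.ne'
  refine ⟨h2.trans (le_of_eq ?_), fun ν => (h1 ν).trans (le_of_eq ?_), h0.trans (le_of_eq (by ring))⟩
  · field_simp
  · field_simp

end V1

/-! ## §3  In print's norm `|·|₍α₎ = sup_j sup_{Ω_j}(Lʲη)^{−α}|·|` with `η`: the dictionary on a finite carrier, and (1.59) restated -/

section MSup

variable {ℓ Mh k R : ℕ} {P : Fin (d + 1) → ℕ} (D : TDomains d ℓ Mh k P R) {X : Type} [Fintype X]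
  (blk : X → ↥(bset D.toDomains))

/-- the p. 86 scale factor at `α = −n` with the spacing `η > 0`: `((Lʲ)η)^{−n} = (((Lʲ)η)ⁿ)⁻¹`.
[cite: Balaban1985RegularSpaces, p.86 (definition after (1.55))] -/
private theorem scale_rpow_neg_eta (ℓ j n : ℕ) {η : ℝ} (hη : 0 < η) :
    ((((ℓ + 1 : ℕ) : ℝ)) ^ j * η) ^ (-(n : ℝ)) = ((((ℓ : ℝ) + 1) ^ j * η) ^ n)⁻¹ := by
  rw [castL, Real.rpow_neg (mul_nonneg (pow_nonneg (by positivity) j) hη.le), Real.rpow_natCast]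

/-- **THE p. 86 NORM ON A FINITE CARRIER IS FINITE, ANY SPACING `η ≥ 0`**: the weighted family `((Lʲ)η)ⁿ‖u(z)‖`, `j ≤ k`, is bounded (the
side condition `Bdd` of the typed `sup_j sup_{Ω_j}`; twin of `B8Ineq159MultiLevelTorusL0.bdd_blk`, `η = 1`).
[cite: Balaban1985RegularSpaces, p.86 (definition after (1.55))] -/
theorem bdd_blk_eta (n : ℕ) {η : ℝ} (hη : 0 ≤ η) (u : X → ℝ) :
    Bdd (ℓ + 1) k η (-(n : ℝ)) (fun j (z : X) => j ≤ (blk z).val.1) u := by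
  classical
  refine ⟨∑ z : X, ∑ j ∈ Finset.range (k + 1), weight (ℓ + 1) η (-(n : ℝ)) j * ‖u z‖, fun j hj z _ => ?_⟩
  have hw : ∀ j' z', 0 ≤ weight (ℓ + 1) η (-(n : ℝ)) j' * ‖u z'‖ := fun j' z' =>
    mul_nonneg (B8ScaledSupNorm.weight_nonneg _ hη _ _) (norm_nonneg _)
  calc weight (ℓ + 1) η (-(n : ℝ)) j * ‖u z‖
      ≤ ∑ j' ∈ Finset.range (k + 1), weight (ℓ + 1) η (-(n : ℝ)) j' * ‖u z‖ :=
        Finset.single_le_sum (f := fun j' => weight (ℓ + 1) η (-(n : ℝ)) j' * ‖u z‖) (fun j' _ => hw j' z)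
          (Finset.mem_range.2 (Nat.lt_succ_of_le hj))
    _ ≤ ∑ z' : X, ∑ j' ∈ Finset.range (k + 1), weight (ℓ + 1) η (-(n : ℝ)) j' * ‖u z'‖ :=
        Finset.single_le_sum (f := fun z' => ∑ j' ∈ Finset.range (k + 1), weight (ℓ + 1) η (-(n : ℝ)) j' * ‖u z'‖)
          (fun z' _ => Finset.sum_nonneg fun j' _ => hw j' z') (Finset.mem_univ z)

/-- **DICTIONARY, NORM ⇒ POINTWISE, SPACING `η`**: `|u|₍₋ₙ₎ ≦ S` in `msup (ℓ+1) k η (−n)` gives `|u(z)| ≦ S·((L^{j(z)})η)⁻ⁿ` at every object read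
at its own level ([4] p. 397 «For α negative we can take Ω_j instead of Ω_j∖Ω_{j+1}»).
[cite: Balaban1985RegularSpaces, p.86 (definition after (1.55)), (1.62) p.87; Balaban1985BackgroundPropagators, (3.41) p.397] -/
theorem pointwise_of_msup_le_blk_eta (n : ℕ) {η : ℝ} (hη : 0 < η) {u : X → ℝ} {S : ℝ}
    (h : msup (ℓ + 1) k η (-(n : ℝ)) (fun j (z : X) => j ≤ (blk z).1.1) u ≤ S) (z : X) :
    |u z| ≤ S * (((B6Geom246MultiLevelTorusL0.geomT D).len (blk z) * η) ^ n)⁻¹ := by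
  have h1 := norm_le_of_msup_le (E := ℝ) (by omega : 1 ≤ ℓ + 1) hη (bdd_blk_eta D blk n hη.le u) h
    (scale_bounds D.toDomains (blk z)).2 (i := z) le_rfl
  rw [Real.norm_eq_abs, scale_rpow_neg_eta ℓ _ n hη] at h1
  rw [lenT_eq]
  exact h1

omit [Fintype X] in
/-- **DICTIONARY, POINTWISE ⇒ NORM, SPACING `η`**: `|u(z)| ≦ S·((L^{j(z)})η)⁻ⁿ` at every object (`S ≥ 0`) gives `|u|₍₋ₙ₎ ≦ S` in
`msup (ℓ+1) k η (−n)` (on `Ω_j ∋ z` one has `j ≤ j(z)`, so `((L^{j(z)})η)⁻ⁿ ≦ ((Lʲ)η)⁻ⁿ`).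
[cite: Balaban1985RegularSpaces, p.86 (definition after (1.55)); Balaban1985BackgroundPropagators, (3.41) p.397] -/
theorem msup_le_of_pointwise_blk_eta (n : ℕ) {η : ℝ} (hη : 0 < η) {u : X → ℝ} {S : ℝ} (hS : 0 ≤ S)
    (h : ∀ z : X, |u z| ≤ S * (((B6Geom246MultiLevelTorusL0.geomT D).len (blk z) * η) ^ n)⁻¹) :
    msup (ℓ + 1) k η (-(n : ℝ)) (fun j (z : X) => j ≤ (blk z).1.1) u ≤ S := by
  refine msup_le_of_pointwise (E := ℝ) (by omega : 1 ≤ ℓ + 1) hη hS fun j _ z hjz => ?_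
  rw [Real.norm_eq_abs, scale_rpow_neg_eta ℓ j n hη]
  have hL1 : (1 : ℝ) ≤ (ℓ : ℝ) + 1 := by linarith [(Nat.cast_nonneg ℓ : (0 : ℝ) ≤ ℓ)]
  have hj : (((ℓ : ℝ) + 1) ^ j * η) ^ n ≤ (((ℓ : ℝ) + 1) ^ (blk z).1.1 * η) ^ n :=
    pow_le_pow_left₀ (by positivity) (mul_le_mul_of_nonneg_right (pow_le_pow_right₀ hL1 hjz) hη.le) n
  have hjpos : 0 < (((ℓ : ℝ) + 1) ^ j * η) ^ n := by positivity
  have hz := h z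
  rw [lenT_eq] at hz
  exact hz.trans (mul_le_mul_of_nonneg_left ((inv_le_inv₀ (by positivity) hjpos).2 hj) hS)

end MSup

section MSupV1

/-- **(1.59) IN PRINT'S OWN NORM WITH THE SPACING `η`, AT U₀ = 1 ON THE `k`-LEVEL V1 TORUS — «|G(U₀)X|₍₋₁₎, |∇_{U₀}G(U₀)X|₍₋₂₎, |Δ_{U₀}G(U₀)X|₍₋₃₎
≦ B₀|X|₍₋₃₎»** with `|·|₍α₎ = B8ScaledSupNorm.msup (ℓ+1) k η α` («sup_j sup_{Ω_j}(Lʲη)^{−α}|·|», `Ω_j := {b : j ≤ level of b}`) on the fine vector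
fields, the three Prop.-2.6 majorants with prefactors `((Lʲ)η)², (Lʲ)η, 1` and constant `C ≥ 0` as hypotheses: for every vector field `X`,
`|Gv X|₍₋₁₎ ≦ B₀C|X|₍₋₃₎`, `|DGv ν X|₍₋₂₎ ≦ B₀C|X|₍₋₃₎` (every `ν`), `|LGv X|₍₋₃₎ ≦ B₀C|X|₍₋₃₎` — the printed shape symbol for symbol, `B₀ = B₀(d, ℓ, σ)`
INDEPENDENT OF `η` («depend on d and L only»).
[cite: Balaban1985RegularSpaces, (1.59) p.86, p.86 (definition after (1.55)), Prop. 3 p.87; Balaban1985BackgroundPropagators, (3.47) p.398, (3.41) p.397, Theorem 3.3 p.399; Balaban1984PropagatorsII, Prop. 2.6 (2.136) p.247] -/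
theorem ineq159_multiLevelTorus_V1_msup_eta (d ℓ : ℕ) {σ : ℝ} (hσ : 0 < σ) :
    ∃ B₀ : ℝ, ∃ N₁ : ℕ, 1 ≤ B₀ ∧ 0 < N₁ ∧
      ∀ (k Mh R : ℕ), 1 ≤ Mh → N₁ + 1 ≤ R * ((ℓ + 1) * Mh) →
      ∀ (P' : Fin (d + 1) → ℕ) (_hP : ∀ μ, 1 ≤ P' μ) (D : B6MultiLevelTorusOperatorL0.TDomains d ℓ Mh k P' R)
        (m K : ℕ) (hd : 1 ≤ d + 1) (hL : Odd (ℓ + 1) ∧ 1 < ℓ + 1)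
        (hN : ∀ μ, N0 ℓ Mh k P' μ = (PV d ℓ m K hd hL).sitesPerDir 0) (η : ℝ), 0 < η → ∀ (C : ℝ), 0 ≤ C →
        ∀ (Gv LGv : Module.End ℝ (PBond (PV d ℓ m K hd hL) 0 → ℝ))
        (DGv : Fin (d + 1) → Module.End ℝ (PBond (PV d ℓ m K hd hL) 0 → ℝ)),
        HasMajorant (g := geomT D) (blkV1 hN D) Gv
          (fun y y' => C * ((geomT D).len y * η) ^ 2 * Real.exp (-(σ * (geomT D).dist y y'))) →
        (∀ ν, HasMajorant (g := geomT D) (blkV1 hN D) (DGv ν)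
          (fun y y' => C * ((geomT D).len y * η) * Real.exp (-(σ * (geomT D).dist y y')))) →
        HasMajorant (g := geomT D) (blkV1 hN D) LGv
          (fun y y' => C * Real.exp (-(σ * (geomT D).dist y y'))) →
        ∀ Xv : PBond (PV d ℓ m K hd hL) 0 → ℝ,
          msup (ℓ + 1) k η (-1) (fun j (b : PBond (PV d ℓ m K hd hL) 0) => j ≤ (blkV1 hN D b).1.1) (Gv Xv) ≤
            B₀ * C * msup (ℓ + 1) k η (-3) (fun j (b : PBond (PV d ℓ m K hd hL) 0) => j ≤ (blkV1 hN D b).1.1) Xv ∧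
          (∀ ν, msup (ℓ + 1) k η (-2) (fun j (b : PBond (PV d ℓ m K hd hL) 0) => j ≤ (blkV1 hN D b).1.1) (DGv ν Xv) ≤
            B₀ * C * msup (ℓ + 1) k η (-3) (fun j (b : PBond (PV d ℓ m K hd hL) 0) => j ≤ (blkV1 hN D b).1.1) Xv) ∧
          msup (ℓ + 1) k η (-3) (fun j (b : PBond (PV d ℓ m K hd hL) 0) => j ≤ (blkV1 hN D b).1.1) (LGv Xv) ≤
            B₀ * C * msup (ℓ + 1) k η (-3) (fun j (b : PBond (PV d ℓ m K hd hL) 0) => j ≤ (blkV1 hN D b).1.1) Xv := by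
  obtain ⟨B₀, N₁, hB₀, hN₁, h⟩ := ineq159_multiLevelTorus_V1_three_eta d ℓ hσ
  refine ⟨B₀, N₁, hB₀, hN₁, ?_⟩
  intro k Mh R hMh1 hRM1 P' hP D m K hd hL hN η hη C hC Gv LGv DGv hG hD hLap Xv
  set S : ℝ := msup (ℓ + 1) k η (-3) (fun j (b : PBond (PV d ℓ m K hd hL) 0) => j ≤ (blkV1 hN D b).1.1) Xv with hSdef
  have e3 : (-3 : ℝ) = -((3 : ℕ) : ℝ) := by norm_num
  have e2 : (-2 : ℝ) = -((2 : ℕ) : ℝ) := by norm_num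
  have e1 : (-1 : ℝ) = -((1 : ℕ) : ℝ) := by norm_num
  have hS : 0 ≤ S := msup_nonneg _ _ hη.le _ _ _
  have hX : ∀ b : PBond (PV d ℓ m K hd hL) 0, |Xv b| ≤ S * (((geomT D).len (blkV1 hN D b) * η) ^ 3)⁻¹ := by
    have hle : msup (ℓ + 1) k η (-((3 : ℕ) : ℝ)) (fun j (b : PBond (PV d ℓ m K hd hL) 0) => j ≤ (blkV1 hN D b).1.1) Xv ≤ S := by
      rw [← e3]
    exact pointwise_of_msup_le_blk_eta D (blkV1 hN D) 3 hη hle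
  have hb := h k Mh R hMh1 hRM1 P' hP D m K hd hL hN η hη C hC Gv LGv DGv hG hD hLap Xv S hS hX
  have hBS : 0 ≤ B₀ * C * S := mul_nonneg (mul_nonneg (by linarith) hC) hS
  refine ⟨?_, fun ν => ?_, ?_⟩
  · rw [e1]
    refine msup_le_of_pointwise_blk_eta D (blkV1 hN D) 1 hη hBS fun b => ?_
    rw [pow_one]
    exact (hb b).1
  · rw [e2]
    refine msup_le_of_pointwise_blk_eta D (blkV1 hN D) 2 hη hBS fun b => ?_
    exact (hb b).2.1 ν
  · rw [e3]
    refine msup_le_of_pointwise_blk_eta D (blkV1 hN D) 3 hη hBS fun b => ?_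
    exact (hb b).2.2

end MSupV1

/-! ## §4  (1.58)'s second summand in `η`-units; r03's `GlobalBand` and `pref` read as this file's window and prefactor -/

section Source

variable {ℓ : ℕ} {m K : ℕ} {hd : 1 ≤ d + 1} {hL : Odd (ℓ + 1) ∧ 1 < ℓ + 1} {Mh k R : ℕ} {P' : Fin (d + 1) → ℕ}

/-- **THE SIZE OF (1.58)'s SECOND SUMMAND «G(U₀)Σ_jQ*_jΛ_j(Lʲη)⁻³B₁»'s SOURCE, WITH THE SPACING `η`**: in the tree's letters `Q*aB` with weights
`|w_{(j,c)}| ≦ a₁(Lʲ)^{d+1}((Lʲ)η)⁻²` (print's `a_j = (Lʲη)⁻²` times the block volume of the `ℓ²` normalisation) and data `|B_{(j,c)}| ≦ β((Lʲ)η)⁻¹`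
((1.56) «LʲηQ_jA = B₁» with `|B₁| ≦ β`), at every fine bond `b`: `|(Q*aB)(b)| ≦ 2a₁β·((L^{j(b)})η)⁻³` — «|Σ_jQ*_jΛ_j(Lʲη)⁻³B₁|₍₋₃₎ ≦ 2a₁|B₁|» in
the `η`-weighted norm.  From the `η = 1` lemma `B8Prop3MultiLevelTorusL0.abs_QsE_aE_le` by homogeneity (`a₁ ↦ a₁η⁻²`, `β ↦ βη⁻¹`).
[cite: Balaban1985RegularSpaces, (1.58)–(1.59) p.86, (1.56) p.86; Balaban1984PropagatorsII, (2.3) p.224, (2.16) p.225, (2.18)–(2.20) p.226; Balaban1984PropagatorsI, (1.18) p.20] -/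
theorem abs_QsE_aE_le_eta (hN : ∀ μ, N0 ℓ Mh k P' μ = (PV d ℓ m K hd hL).sitesPerDir 0) (D : B6MultiLevelTorusOperatorL0.TDomains d ℓ Mh k P' R) (hk : k ≤ m + K)
    {η a₁ β : ℝ} (hη : 0 < η) (ha₁ : 0 ≤ a₁) (hβ : 0 ≤ β) (w : BondIdx (domT hN D hk) → ℝ) (B : BondIdxSpace (domT hN D hk))
    (hw : ∀ i, |w i| ≤ a₁ * (((ℓ : ℝ) + 1) ^ (d + 1)) ^ (i.1.1 : ℕ) * ((((ℓ : ℝ) + 1) ^ (i.1.1 : ℕ) * η) ^ 2)⁻¹)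
    (hB : ∀ i, |B i| ≤ β * (((ℓ : ℝ) + 1) ^ (i.1.1 : ℕ) * η)⁻¹) (b : PBond (PV d ℓ m K hd hL) 0) :
    |(QsE (domT hN D hk) (aE (domT hN D hk) w B)) b| ≤ 2 * a₁ * β * (((geomT D).len (blkV1 hN D b) * η) ^ 3)⁻¹ := by
  have hη0 : η ≠ 0 := hη.ne'
  have hη2 : 0 < η ^ 2 := pow_pos hη 2
  have hw' : ∀ i, |w i| ≤ (a₁ * (η ^ 2)⁻¹) * (((ℓ : ℝ) + 1) ^ (d + 1)) ^ (i.1.1 : ℕ) * ((((ℓ : ℝ) + 1) ^ (i.1.1 : ℕ)) ^ 2)⁻¹ := by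
    intro i
    refine (hw i).trans (le_of_eq ?_)
    rw [mul_pow, mul_inv]
    ring
  have hB' : ∀ i, |B i| ≤ (β * η⁻¹) * (((ℓ : ℝ) + 1) ^ (i.1.1 : ℕ))⁻¹ := by
    intro i
    refine (hB i).trans (le_of_eq ?_)
    rw [mul_inv]
    ring
  have h := abs_QsE_aE_le hN D hk (mul_nonneg ha₁ (inv_nonneg.2 hη2.le)) (mul_nonneg hβ (inv_nonneg.2 hη.le)) w B hw' hB' b
  refine h.trans (le_of_eq ?_)
  rw [mul_pow, mul_inv]
  field_simp

/-- **r03's GLOBAL WEIGHT BAND IS THIS FILE'S WINDOW** (print's (2.16) weights `a_j` in the units of the V1 factor `c′`): `GlobalBand b₀ b₁ c′ w`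
(`B6CubeWindowV1`: `b₀(Lʲ)^{d+1} ≦ w_{(j,c)}/(c′/Lʲ)² ≦ b₁(Lʲ)^{d+1}`, `b₀ ≥ 0`) gives `|w_{(j,c)}| ≦ b₁(Lʲ)^{d+1}((Lʲ)·|c′|⁻¹)⁻²` — the window of
`abs_QsE_aE_le_eta` with `a₁ := b₁`, `η := |c′|⁻¹`.
[cite: Balaban1984PropagatorsII, (2.16) p.225, (2.90) p.239; Balaban1985RegularSpaces, (1.58) p.86 («Σ_jQ*_jΛ_j(Lʲη)⁻²Q_j»), dictionary] -/
theorem window_of_globalBand (hN : ∀ μ, N0 ℓ Mh k P' μ = (PV d ℓ m K hd hL).sitesPerDir 0) (D : B6MultiLevelTorusOperatorL0.TDomains d ℓ Mh k P' R) (hk : k ≤ m + K)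
    {b₀ b₁ cf : ℝ} (hb₀ : 0 ≤ b₀) (hcf : cf ≠ 0) {w : BondIdx (domT hN D hk) → ℝ} (hwb : GlobalBand b₀ b₁ cf w)
    (i : BondIdx (domT hN D hk)) :
    |w i| ≤ b₁ * (((ℓ : ℝ) + 1) ^ (d + 1)) ^ (i.1.1 : ℕ) * ((((ℓ : ℝ) + 1) ^ (i.1.1 : ℕ) * |cf|⁻¹) ^ 2)⁻¹ := by
  obtain ⟨h1, h2⟩ := hwb i
  rw [castL] at h1 h2
  set Lj : ℝ := ((ℓ : ℝ) + 1) ^ (i.1.1 : ℕ) with hLj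
  have hLjpos : 0 < Lj := by rw [hLj]; positivity
  have hq : 0 < (cf / Lj) ^ 2 := by positivity
  have hX : 0 ≤ Lj ^ (d + 1) := by positivity
  -- the weight is non-negative (lower band with `b₀ ≥ 0`)
  have hw0 : 0 ≤ w i := by
    have h0 : 0 ≤ w i / (cf / Lj) ^ 2 := le_trans (mul_nonneg hb₀ hX) h1
    have := mul_nonneg h0 hq.le
    rwa [div_mul_cancel₀ _ hq.ne'] at this
  rw [abs_of_nonneg hw0]
  have h3 : w i ≤ b₁ * Lj ^ (d + 1) * (cf / Lj) ^ 2 := by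
    have := (div_le_iff₀ hq).1 h2
    linarith [this]
  refine h3.trans (le_of_eq ?_)
  have hcf' : |cf| ≠ 0 := abs_ne_zero.2 hcf
  rw [← pow_right_comm, mul_pow, inv_pow, sq_abs]
  field_simp

/-- **r03's (2.136)₁ PREFACTOR IS `((Lʲ)η)²` WITH `η = |c′|⁻¹`**: `B6Prop26KLevelSkeletonV1L0.pref c′ y = ((L^{j(y)})·|c′|⁻¹)²`.
[cite: Balaban1984PropagatorsII, Prop. 2.6 (2.136) p.247 («O(1)(Lʲη)²»), dictionary] -/
theorem pref_eq (D : B6MultiLevelTorusOperatorL0.TDomains d ℓ Mh k P' R) (cf : ℝ) (y : (geomT D).Site) :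
    pref cf y = ((geomT D).len y * |cf|⁻¹) ^ 2 := by
  unfold pref
  rw [castL, lenT_eq, div_eq_mul_inv, mul_pow, mul_pow, inv_pow, inv_pow, sq_abs]

end Source

/-! ## §5  (1.59) in print's shape for the `|A|₍₋₁₎` member of THE genuine `k`-level `G(1)`, `η` explicit, modulo its (2.136)₁ majorant -/

section Printed

/-- **(1.59), THE `|A|₍₋₁₎` MEMBER IN PRINT'S SHAPE «|A|₍₋₁₎ ≦ B₀′(|J|₍₋₃₎ + |B₁|)» FOR THE GENUINE `k`-LEVEL `G(1) = Δ_a⁻¹` OF THE V1 TORUS, SPACING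
`η` EXPLICIT, MODULO ITS (2.136)₁ MAJORANT** (twin of `B8Prop3MultiLevelTorusL0.ineq159_A_member_printed_V1`, `η = 1`): for every `σ > 0` there are
`B₀ ≥ 1`, `N₁ ≥ 1` (functions of `d, ℓ, σ`) such that on every admissible torus datum, for every V1 factor `c′ ≠ 0`, weights `w > 0`, EVERY `η > 0`,
window `|w_{(j,c)}| ≦ a₁(Lʲ)^{d+1}((Lʲ)η)⁻²` (`a₁ ≥ 0`) and EVERY `C ≥ 0`: IF `onFun (GE (domT hN D hk) hc′ hw)` has the majorant `C((Lʲ)η)²e^{−σd_T}`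
on `blkV1 hN D`, THEN every vector field `A` with (1.55) `∂*∂A = J`, (1.42) `R∂*A = 0`, (1.56) `QA = B`, `|J(b)| ≦ n_J((L^{j(b)})η)⁻³` («|J|₍₋₃₎ ≦
n_J») and `|B_{(j,c)}| ≦ β((Lʲ)η)⁻¹` («LʲηQ_jA = B₁, |B₁| ≦ β») obeys `|A(b)| ≦ B₀C(1 + 2a₁)(n_J + β)((L^{j(b)})η)⁻¹` — «|A|₍₋₁₎ ≦ B₀′(|J|₍₋₃₎ +
|B₁|)», `B₀′ = B₀C(1 + 2a₁)` INDEPENDENT OF `η`.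
[cite: Balaban1985RegularSpaces, (1.58)–(1.59) p.86, (1.55)–(1.56) p.86, Prop. 3 p.87; Balaban1985BackgroundPropagators, Theorem 3.3 p.399, (3.47) p.398; Balaban1984PropagatorsII, Prop. 2.6 (2.136) p.247, (2.19)–(2.20) p.226] -/
theorem ineq159_A_member_printed_V1_eta (d ℓ : ℕ) {σ : ℝ} (hσ : 0 < σ) :
    ∃ B₀ : ℝ, ∃ N₁ : ℕ, 1 ≤ B₀ ∧ 0 < N₁ ∧
      ∀ (k Mh R : ℕ), 1 ≤ Mh → N₁ + 1 ≤ R * ((ℓ + 1) * Mh) →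
      ∀ (P' : Fin (d + 1) → ℕ) (_hP : ∀ μ, 1 ≤ P' μ) (D : B6MultiLevelTorusOperatorL0.TDomains d ℓ Mh k P' R)
        (m K : ℕ) (hd : 1 ≤ d + 1) (hL : Odd (ℓ + 1) ∧ 1 < ℓ + 1)
        (hN : ∀ μ, N0 ℓ Mh k P' μ = (PV d ℓ m K hd hL).sitesPerDir 0) (hk : k ≤ m + K)
        (cf : ℝ) (hcf : cf ≠ 0) (w : BondIdx (domT hN D hk) → ℝ) (hw : ∀ i, 0 < w i) (η : ℝ), 0 < η →
        ∀ (a₁ : ℝ), 0 ≤ a₁ →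
        (∀ i, |w i| ≤ a₁ * (((ℓ : ℝ) + 1) ^ (d + 1)) ^ (i.1.1 : ℕ) * ((((ℓ : ℝ) + 1) ^ (i.1.1 : ℕ) * η) ^ 2)⁻¹) →
        ∀ (C : ℝ), 0 ≤ C →
        HasMajorant (g := geomT D) (blkV1 hN D) (onFun (GE (domT hN D hk) hcf hw))
          (fun y y' => C * ((geomT D).len y * η) ^ 2 * Real.exp (-(σ * (geomT D).dist y y'))) →
        ∀ (A J : BondSpace (PV d ℓ m K hd hL)) (B : BondIdxSpace (domT hN D hk)),
          dcsE cf (dcE cf A) = J → RE (domT hN D hk) cf (dsE cf A) = 0 → QE (domT hN D hk) A = B →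
          ∀ (nJ β : ℝ), 0 ≤ nJ → 0 ≤ β →
            (∀ b, |J b| ≤ nJ * (((geomT D).len (blkV1 hN D b) * η) ^ 3)⁻¹) →
            (∀ i, |B i| ≤ β * (((ℓ : ℝ) + 1) ^ (i.1.1 : ℕ) * η)⁻¹) →
            ∀ b : PBond (PV d ℓ m K hd hL) 0,
              |A b| ≤ B₀ * C * (1 + 2 * a₁) * (nJ + β) * ((geomT D).len (blkV1 hN D b) * η)⁻¹ := by
  obtain ⟨B₀, N₁, hB₀, hN₁, h⟩ := sup347_eta d ℓ hσ 3
  refine ⟨B₀, N₁, hB₀, hN₁, ?_⟩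
  intro k Mh R hMh1 hRM1 P' hP D m K hd hL hN hk cf hcf w hw η hη a₁ ha₁ hwin C hC hG A J B h55 h42 h56 nJ β hnJ hβ hJ hB b
  -- (1.58) line 2 for the genuine operator
  have hA := eq158_line2_V1 (domT hN D hk) hcf hw A J B h55 h42 h56
  -- the source `X = J + Q*aB` in the `η`-weighted `(−3)`-norm, the second summand inserted by §4
  have hS : 0 ≤ (1 + 2 * a₁) * (nJ + β) := by positivity
  have hX : ∀ b' : PBond (PV d ℓ m K hd hL) 0,
      |(J + QsE (domT hN D hk) (aE (domT hN D hk) w B)) b'| ≤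
        (1 + 2 * a₁) * (nJ + β) * (((geomT D).len (blkV1 hN D b') * η) ^ 3)⁻¹ := by
    intro b'
    have h2 := abs_QsE_aE_le_eta hN D hk hη ha₁ hβ w B hwin hB b'
    have hl0 : 0 ≤ (((geomT D).len (blkV1 hN D b') * η) ^ 3)⁻¹ :=
      inv_nonneg.2 (pow_nonneg (mul_nonneg (lenT_pos D _).le hη.le) 3)
    have hadd : (J + QsE (domT hN D hk) (aE (domT hN D hk) w B)) b' =
        J b' + (QsE (domT hN D hk) (aE (domT hN D hk) w B)) b' := rfl
    rw [hadd]
    refine (abs_add_le _ _).trans ?_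
    have := hJ b'
    nlinarith [mul_nonneg ha₁ hβ, mul_nonneg hnJ hl0, mul_nonneg hβ hl0, mul_nonneg (mul_nonneg ha₁ hnJ) hl0]
  have key := h k Mh R hMh1 hRM1 P' hP D η hη 2 _ (blkV1 hN D) (onFun (GE (domT hN D hk) hcf hw)) C hC hG
    (WithLp.ofLp (J + QsE (domT hN D hk) (aE (domT hN D hk) w B))) _ hS hX b
  rw [onFun_apply, WithLp.toLp_ofLp, ← hA] at key
  have hm : 0 < (geomT D).len (blkV1 hN D b) * η := mul_pos (lenT_pos D _) hη
  have hm0 : (geomT D).len (blkV1 hN D b) * η ≠ 0 := hm.ne'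
  refine key.trans (le_of_eq ?_)
  field_simp

end Printed

/-! ## §6  PROPOSITION 3 AT U₀ = 1 ON THE `k`-LEVEL TORUS, VECTOR SIDE, `η` EXPLICIT, MODULO THE THREE (2.136) MAJORANTS OF `G(1)`, `∇G(1)`, `ΔG(1)` -/

section Prop3

set_option maxHeartbeats 400000 in
/-- **PROPOSITION 3 (p. 87) AT U₀ = 1 ON THE `k`-LEVEL V1 TORUS WITH THE LATTICE SPACING `η`, FOR THE GENUINE `G(1) = Δ_a⁻¹`, MODULO THE THREE
(2.136)-SHAPE MAJORANTS, `B₀` INDEPENDENT OF `η`** («then U₁ satisfies (1.36)–(1.39) with B₁ = 5dLB₀ … where B₀ … are the corresponding norms of the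
operators G(U₀) … and depend on d and L only»; here (1.62) = the four `A`-members of (1.36), vector side): for every `σ > 0` there are `B₀ ≥ 1`,
`N₁ ≥ 1` (functions of `d, ℓ, σ`) such that on every admissible torus datum (`M_h ≥ 1`, `R·L·M_h ≥ N₁ + 1`, `P′_μ ≥ 1`, `D`, V1 volume with `hN`,
`hk`), for every factor `c′ ≠ 0`, weights `w > 0`, EVERY SPACING `η > 0`, window `|w_{(j,c)}| ≦ a₁(Lʲ)^{d+1}((Lʲ)η)⁻²`, EVERY `C ≥ 0` and linear
maps `Dop ν` (`ν : Fin (d+1)`, standing for `∇^η_{U₀}|_{U₀=1}` componentwise), `Lop` (for `Δ^η_{U₀}|_{U₀=1}`): IF `onFun G(1)`, `Dop ν ∘ onFun G(1)`,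
`Lop ∘ onFun G(1)` have the majorants `C((Lʲ)η)²e^{−σd_T}`, `C(Lʲ)ηe^{−σd_T}`, `Ce^{−σd_T}` on `blkV1 hN D`, THEN for every `A` with (1.55) `∂*∂A = J`,
(1.42) `R∂*A = 0`, (1.56) `QA = B` and numbers `n_J, n_B ≥ 0` with `|J(b)| ≦ n_J((L^{j(b)})η)⁻³` («|J|₍₋₃₎ ≦ n_J»), `|B_{(j,c)}| ≦ n_B((Lʲ)η)⁻¹`
(«LʲηQ_jA = B₁, |B₁| ≦ n_B»), and reals `d_P ≥ 0`, `L_P` with `d_PL_P ≥ 1`, `α₀, α₁, α₂ ≥ 0`, `C₂` subject to (1.55) «|J|₍₋₃₎ ≦ 2α₀ + 36dα₂|∇A|₍₋₂₎ +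
50dα₂³ + 10dα₀α₂» (with `|∇A|₍₋₂₎ := msup (ℓ+1) k η (−2)` of `(ν, b) ↦ (Dop ν A)(b)`), (1.56) «|B₁| < 2dLα₁ + C₂α₂²», p. 86 «B₀′36dα₂ ≦ ½»
(+ `50dα₂ ≤ 1`) and (1.61): with `B₀′ := (B₀C + 1)(1 + 2a₁)` (INDEPENDENT OF `η`),
**`|A|₍₋₁₎, |∇A|₍₋₂₎, |J|₍₋₃₎ (= |D*DA|₍₋₃₎), |ΔA|₍₋₃₎ ≦ 5d_PL_PB₀′(α₀ + α₁)`** in `msup (ℓ+1) k η ·`, and, as printed in (1.62) «on Ω_j»,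
`|A(b)| ≦ 5d_PL_PB₀′(α₀ + α₁)((L^{j(b)})η)⁻¹`, `|(Dop ν A)(b)| ≦ …((L^{j(b)})η)⁻²`, `|(Lop A)(b)| ≦ …((L^{j(b)})η)⁻³` at every fine bond.
[cite: Balaban1985RegularSpaces, Prop. 3 p.87, (1.59)–(1.62) pp.86–87, (1.55)–(1.58) p.86, p.86 (definition after (1.55)); Balaban1985BackgroundPropagators, Theorem 3.3 p.399, (3.47) p.398; Balaban1984PropagatorsII, Prop. 2.6 (2.136) p.247, (2.19) p.226] -/
theorem prop3_multiLevelTorus_V1_eta (d ℓ : ℕ) {σ : ℝ} (hσ : 0 < σ) :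
    ∃ B₀ : ℝ, ∃ N₁ : ℕ, 1 ≤ B₀ ∧ 0 < N₁ ∧
      ∀ (k Mh R : ℕ), 1 ≤ Mh → N₁ + 1 ≤ R * ((ℓ + 1) * Mh) →
      ∀ (P' : Fin (d + 1) → ℕ) (_hP : ∀ μ, 1 ≤ P' μ) (D : B6MultiLevelTorusOperatorL0.TDomains d ℓ Mh k P' R)
        (m K : ℕ) (hd : 1 ≤ d + 1) (hL : Odd (ℓ + 1) ∧ 1 < ℓ + 1)
        (hN : ∀ μ, N0 ℓ Mh k P' μ = (PV d ℓ m K hd hL).sitesPerDir 0) (hk : k ≤ m + K)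
        (cf : ℝ) (hcf : cf ≠ 0) (w : BondIdx (domT hN D hk) → ℝ) (hw : ∀ i, 0 < w i) (η : ℝ) (_hη : 0 < η)
        (a₁ : ℝ) (_ha₁ : 0 ≤ a₁)
        (_hwin : ∀ i, |w i| ≤ a₁ * (((ℓ : ℝ) + 1) ^ (d + 1)) ^ (i.1.1 : ℕ) * ((((ℓ : ℝ) + 1) ^ (i.1.1 : ℕ) * η) ^ 2)⁻¹)
        (C : ℝ) (_hC : 0 ≤ C)
        (Dop : Fin (d + 1) → Module.End ℝ (PBond (PV d ℓ m K hd hL) 0 → ℝ))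
        (Lop : Module.End ℝ (PBond (PV d ℓ m K hd hL) 0 → ℝ)),
        HasMajorant (g := geomT D) (blkV1 hN D) (onFun (GE (domT hN D hk) hcf hw))
          (fun y y' => C * ((geomT D).len y * η) ^ 2 * Real.exp (-(σ * (geomT D).dist y y'))) →
        (∀ ν, HasMajorant (g := geomT D) (blkV1 hN D) (Dop ν ∘ₗ onFun (GE (domT hN D hk) hcf hw))
          (fun y y' => C * ((geomT D).len y * η) * Real.exp (-(σ * (geomT D).dist y y')))) →
        HasMajorant (g := geomT D) (blkV1 hN D) (Lop ∘ₗ onFun (GE (domT hN D hk) hcf hw))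
          (fun y y' => C * Real.exp (-(σ * (geomT D).dist y y'))) →
        ∀ (A J : BondSpace (PV d ℓ m K hd hL)) (B : BondIdxSpace (domT hN D hk)),
          dcsE cf (dcE cf A) = J → RE (domT hN D hk) cf (dsE cf A) = 0 → QE (domT hN D hk) A = B →
          ∀ (nJ nB : ℝ), 0 ≤ nJ → 0 ≤ nB →
            (∀ b, |J b| ≤ nJ * (((geomT D).len (blkV1 hN D b) * η) ^ 3)⁻¹) →
            (∀ i, |B i| ≤ nB * (((ℓ : ℝ) + 1) ^ (i.1.1 : ℕ) * η)⁻¹) →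
          ∀ (dP LP C₂ α₀ α₁ α₂ : ℝ), 0 ≤ dP → 1 ≤ dP * LP → 0 ≤ α₀ → 0 ≤ α₁ → 0 ≤ α₂ →
            nJ ≤ 2 * α₀ + 36 * dP * α₂ *
                msup (ℓ + 1) k η (-2) (fun j (p : Fin (d + 1) × PBond (PV d ℓ m K hd hL) 0) => j ≤ (blkV1 hN D p.2).1.1)
                  (fun p : Fin (d + 1) × PBond (PV d ℓ m K hd hL) 0 => Dop p.1 (WithLp.ofLp A) p.2) +
              50 * dP * α₂ ^ 3 + 10 * dP * α₀ * α₂ →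
            nB ≤ 2 * dP * LP * α₁ + C₂ * α₂ ^ 2 →
            36 * dP * ((B₀ * C + 1) * (1 + 2 * a₁)) * α₂ ≤ 1 / 2 → 50 * dP * α₂ ≤ 1 →
            2 * α₂ ^ 2 + 20 * dP * α₀ * α₂ + 2 * C₂ * α₂ ^ 2 ≤ α₀ + α₁ →
            msup (ℓ + 1) k η (-1) (fun j (b : PBond (PV d ℓ m K hd hL) 0) => j ≤ (blkV1 hN D b).1.1) (WithLp.ofLp A) ≤
                5 * dP * LP * ((B₀ * C + 1) * (1 + 2 * a₁)) * (α₀ + α₁) ∧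
              msup (ℓ + 1) k η (-2) (fun j (p : Fin (d + 1) × PBond (PV d ℓ m K hd hL) 0) => j ≤ (blkV1 hN D p.2).1.1)
                  (fun p : Fin (d + 1) × PBond (PV d ℓ m K hd hL) 0 => Dop p.1 (WithLp.ofLp A) p.2) ≤
                5 * dP * LP * ((B₀ * C + 1) * (1 + 2 * a₁)) * (α₀ + α₁) ∧
              nJ ≤ 5 * dP * LP * ((B₀ * C + 1) * (1 + 2 * a₁)) * (α₀ + α₁) ∧
              msup (ℓ + 1) k η (-3) (fun j (b : PBond (PV d ℓ m K hd hL) 0) => j ≤ (blkV1 hN D b).1.1) (Lop (WithLp.ofLp A)) ≤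
                5 * dP * LP * ((B₀ * C + 1) * (1 + 2 * a₁)) * (α₀ + α₁) ∧
              -- (1.62) as printed, «on Ω_j»: the pointwise forms at every fine bond read at its own level
              (∀ b : PBond (PV d ℓ m K hd hL) 0,
                |WithLp.ofLp A b| ≤ 5 * dP * LP * ((B₀ * C + 1) * (1 + 2 * a₁)) * (α₀ + α₁) *
                  (((geomT D).len (blkV1 hN D b) * η) ^ 1)⁻¹) ∧
              (∀ (ν : Fin (d + 1)) (b : PBond (PV d ℓ m K hd hL) 0),
                |Dop ν (WithLp.ofLp A) b| ≤ 5 * dP * LP * ((B₀ * C + 1) * (1 + 2 * a₁)) * (α₀ + α₁) *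
                  (((geomT D).len (blkV1 hN D b) * η) ^ 2)⁻¹) ∧
              (∀ b : PBond (PV d ℓ m K hd hL) 0,
                |Lop (WithLp.ofLp A) b| ≤ 5 * dP * LP * ((B₀ * C + 1) * (1 + 2 * a₁)) * (α₀ + α₁) *
                  (((geomT D).len (blkV1 hN D b) * η) ^ 3)⁻¹) := by
  obtain ⟨B₀, N₁, hB₀, hN₁, h⟩ := ineq159_multiLevelTorus_V1_eta d ℓ hσ 3
  refine ⟨B₀, N₁, hB₀, hN₁, ?_⟩
  intro k Mh R hMh1 hRM1 P' hP D m K hd hL hN hk cf hcf w hw η hη a₁ ha₁ hwin C hC Dop Lop hG hD hLap A J B h55 h42 h56 nJ nB hnJ hnB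
    hJ hB dP LP C₂ α₀ α₁ α₂ hdP hdL hα₀ hα₁ hα₂ h55s h56s hside h50 h61
  -- (1.58) line 2 for the genuine operator, and the size of its source in the `η`-weighted `(−3)`-norm (§4)
  have hA := eq158_line2_V1 (domT hN D hk) hcf hw A J B h55 h42 h56
  have hS : 0 ≤ (1 + 2 * a₁) * (nJ + nB) := by positivity
  have hX : ∀ b' : PBond (PV d ℓ m K hd hL) 0,
      |(WithLp.ofLp (J + QsE (domT hN D hk) (aE (domT hN D hk) w B))) b'| ≤
        (1 + 2 * a₁) * (nJ + nB) * (((geomT D).len (blkV1 hN D b') * η) ^ 3)⁻¹ := by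
    intro b'
    have h2 := abs_QsE_aE_le_eta hN D hk hη ha₁ hnB w B hwin hB b'
    have hl0 : 0 ≤ (((geomT D).len (blkV1 hN D b') * η) ^ 3)⁻¹ :=
      inv_nonneg.2 (pow_nonneg (mul_nonneg (lenT_pos D _).le hη.le) 3)
    have hadd : (WithLp.ofLp (J + QsE (domT hN D hk) (aE (domT hN D hk) w B))) b' =
        J b' + (QsE (domT hN D hk) (aE (domT hN D hk) w B)) b' := rfl
    rw [hadd]
    refine (abs_add_le _ _).trans ?_
    have := hJ b'
    nlinarith [mul_nonneg ha₁ hnB, mul_nonneg hnJ hl0, mul_nonneg hnB hl0, mul_nonneg (mul_nonneg ha₁ hnJ) hl0]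
  -- the three operator bounds of §2 with `Gv := onFun G(1)`, `DGv ν := Dop ν ∘ onFun G(1)`, `LGv := Lop ∘ onFun G(1)`
  have key := h k Mh R hMh1 hRM1 P' hP D m K hd hL hN η hη C hC (onFun (GE (domT hN D hk) hcf hw))
    (Lop ∘ₗ onFun (GE (domT hN D hk) hcf hw)) (fun ν => Dop ν ∘ₗ onFun (GE (domT hN D hk) hcf hw)) hG hD hLap
    (WithLp.ofLp (J + QsE (domT hN D hk) (aE (domT hN D hk) w B))) _ hS hX
  -- `A = G(1)X` read on functions
  have hAfun : WithLp.ofLp A = onFun (GE (domT hN D hk) hcf hw)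
      (WithLp.ofLp (J + QsE (domT hN D hk) (aE (domT hN D hk) w B))) := by
    funext b
    rw [onFun_apply, WithLp.toLp_ofLp, ← hA]
  -- the constant of this file
  have hBC : 0 ≤ B₀ * C := mul_nonneg (by linarith) hC
  have hBp1 : 1 ≤ (B₀ * C + 1) * (1 + 2 * a₁) := by nlinarith
  have hBp0 : 0 ≤ (B₀ * C + 1) * (1 + 2 * a₁) := by linarith
  have hm : ∀ b : PBond (PV d ℓ m K hd hL) 0, 0 < (geomT D).len (blkV1 hN D b) * η := fun b => mul_pos (lenT_pos D _) hη
  -- the weakening `B₀C ≤ B₀C + 1` against a non-negative product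
  have hweak : ∀ {q v : ℝ}, 0 ≤ q → v ≤ B₀ * C * q * ((1 + 2 * a₁) * (nJ + nB)) →
      v ≤ (B₀ * C + 1) * (1 + 2 * a₁) * (nJ + nB) * q := by
    intro q v hq hv
    refine hv.trans ?_
    have h0 : 0 ≤ q * ((1 + 2 * a₁) * (nJ + nB)) := mul_nonneg hq hS
    nlinarith
  -- member `|A|₍₋₁₎`
  have mA : ∀ b : PBond (PV d ℓ m K hd hL) 0,
      |WithLp.ofLp A b| ≤ (B₀ * C + 1) * (1 + 2 * a₁) * (nJ + nB) * (((geomT D).len (blkV1 hN D b) * η) ^ 1)⁻¹ := by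
    intro b
    have h1 := (key b).1
    rw [← hAfun] at h1
    have hq : 0 ≤ (((geomT D).len (blkV1 hN D b) * η) ^ 1)⁻¹ := inv_nonneg.2 (pow_nonneg (hm b).le 1)
    refine hweak hq (h1.trans (le_of_eq ?_))
    have hl : (geomT D).len (blkV1 hN D b) * η ≠ 0 := (hm b).ne'
    field_simp
  -- member `|∇A|₍₋₂₎` (every component)
  have mD : ∀ p : Fin (d + 1) × PBond (PV d ℓ m K hd hL) 0,
      |Dop p.1 (WithLp.ofLp A) p.2| ≤
        (B₀ * C + 1) * (1 + 2 * a₁) * (nJ + nB) * (((geomT D).len (blkV1 hN D p.2) * η) ^ 2)⁻¹ := by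
    intro p
    have h1 := (key p.2).2.1 p.1
    rw [LinearMap.comp_apply, ← hAfun] at h1
    have hq : 0 ≤ (((geomT D).len (blkV1 hN D p.2) * η) ^ 2)⁻¹ := inv_nonneg.2 (pow_nonneg (hm p.2).le 2)
    refine hweak hq (h1.trans (le_of_eq ?_))
    have hl : (geomT D).len (blkV1 hN D p.2) * η ≠ 0 := (hm p.2).ne'
    field_simp
  -- member `|ΔA|₍₋₃₎`
  have mL : ∀ b : PBond (PV d ℓ m K hd hL) 0,
      |Lop (WithLp.ofLp A) b| ≤ (B₀ * C + 1) * (1 + 2 * a₁) * (nJ + nB) * (((geomT D).len (blkV1 hN D b) * η) ^ 3)⁻¹ := by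
    intro b
    have h1 := (key b).2.2
    rw [LinearMap.comp_apply, ← hAfun] at h1
    have hq : 0 ≤ (((geomT D).len (blkV1 hN D b) * η) ^ 3)⁻¹ := inv_nonneg.2 (pow_nonneg (hm b).le 3)
    exact hweak hq (h1.trans (le_of_eq (by ring)))
  -- (1.59) as norm inequalities
  have e3 : (-3 : ℝ) = -((3 : ℕ) : ℝ) := by norm_num
  have e2 : (-2 : ℝ) = -((2 : ℕ) : ℝ) := by norm_num
  have e1 : (-1 : ℝ) = -((1 : ℕ) : ℝ) := by norm_num
  have hBS : 0 ≤ (B₀ * C + 1) * (1 + 2 * a₁) * (nJ + nB) := by positivity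
  have h59a : msup (ℓ + 1) k η (-1) (fun j (b : PBond (PV d ℓ m K hd hL) 0) => j ≤ (blkV1 hN D b).1.1) (WithLp.ofLp A) ≤
      (B₀ * C + 1) * (1 + 2 * a₁) * (nJ + nB) := by
    rw [e1]; exact msup_le_of_pointwise_blk_eta D (blkV1 hN D) 1 hη hBS mA
  have h59g : msup (ℓ + 1) k η (-2) (fun j (p : Fin (d + 1) × PBond (PV d ℓ m K hd hL) 0) => j ≤ (blkV1 hN D p.2).1.1)
      (fun p : Fin (d + 1) × PBond (PV d ℓ m K hd hL) 0 => Dop p.1 (WithLp.ofLp A) p.2) ≤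
        (B₀ * C + 1) * (1 + 2 * a₁) * (nJ + nB) := by
    rw [e2]
    exact msup_le_of_pointwise_blk_eta D (fun p : Fin (d + 1) × PBond (PV d ℓ m K hd hL) 0 => blkV1 hN D p.2) 2 hη hBS mD
  have h59l : msup (ℓ + 1) k η (-3) (fun j (b : PBond (PV d ℓ m K hd hL) 0) => j ≤ (blkV1 hN D b).1.1) (Lop (WithLp.ofLp A)) ≤
      (B₀ * C + 1) * (1 + 2 * a₁) * (nJ + nB) := by
    rw [e3]; exact msup_le_of_pointwise_blk_eta D (blkV1 hN D) 3 hη hBS mL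
  have h59j : nJ ≤ (B₀ * C + 1) * (1 + 2 * a₁) * (nJ + nB) := by nlinarith
  have hg0 : 0 ≤ msup (ℓ + 1) k η (-2) (fun j (p : Fin (d + 1) × PBond (PV d ℓ m K hd hL) 0) => j ≤ (blkV1 hN D p.2).1.1)
      (fun p : Fin (d + 1) × PBond (PV d ℓ m K hd hL) 0 => Dop p.1 (WithLp.ofLp A) p.2) := msup_nonneg _ _ hη.le _ _ _
  -- (1.60) and (1.62) by the kernel-checked a-priori algebra of `B8`
  obtain ⟨c1, c2, c3, c4⟩ := B8.apriori_160 (d := dP) (L := LP) (C₂ := C₂) hdP hBp0 hα₂ hg0 h55s h56s h59a h59g h59j h59l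
    hside h50
  have h162 := B8.apriori_162 (C₂ := C₂) hBp0 hdL hα₀ hα₁ h61
  have f1 := c1.trans h162
  have f2 := c2.trans h162
  have f4 := c4.trans h162
  refine ⟨f1, f2, c3.trans h162, f4, fun b => ?_, fun ν b => ?_, fun b => ?_⟩
  · rw [e1] at f1
    exact pointwise_of_msup_le_blk_eta D (blkV1 hN D) 1 hη f1 b
  · rw [e2] at f2
    exact pointwise_of_msup_le_blk_eta D (fun p : Fin (d + 1) × PBond (PV d ℓ m K hd hL) 0 => blkV1 hN D p.2) 2 hη f2 (ν, b)
  · rw [e3] at f4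
    exact pointwise_of_msup_le_blk_eta D (blkV1 hN D) 3 hη f4 b

end Prop3

/-! ## §7  THE ROUTE V SOCKET: §5/§6 in r03's letters — slot 1 = `C · pref c′ y · e^{−σd_T}`, the window = `GlobalBand b₀ b₁ c′ w`, `η = |c′|⁻¹` -/

section Socket

/-- **THE ROUTE V SOCKET, `|A|₍₋₁₎` MEMBER**: `ineq159_A_member_printed_V1_eta` with `η := |c′|⁻¹`, the (2.136)₁ hypothesis written LITERALLY in the
conclusion shape of r03's `B6CubeWindowV1L0.prop26_2136_kLevel_cubes_band` — `HasMajorant (geomT D) (blkV1 hN D) (onFun (GE (domT hN D hk) hc′ hw))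
(fun y y′ ↦ C · pref c′ y · e^{−σ d_T(y,y′)})`, ANY `C ≥ 0`, `σ > 0` — and print's (2.16) weight band `GlobalBand b₀ b₁ c′ w` (`0 ≤ b₀`, `0 ≤ b₁`) in
place of the window: every `A` with (1.55) `∂*∂A = J`, (1.42) `R∂*A = 0`, (1.56) `QA = B`, `|J(b)| ≦ n_J((L^{j(b)})η)⁻³`, `|B_{(j,c)}| ≦ β((Lʲ)η)⁻¹`
(`η = |c′|⁻¹`) obeys `|A(b)| ≦ B₀C(1 + 2b₁)(n_J + β)((L^{j(b)})η)⁻¹`, `B₀ = B₀(d, ℓ, σ)`.  (For ROUTE V: `C := (N_ov·A)·K261·(1 − N_ov²θ₀K261)⁻¹`,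
`σ := δ₃ = delta3 α (2δ/(d+1))`, positive for a Lemma-2.1 budget `α < 1`.)
[cite: Balaban1985RegularSpaces, (1.58)–(1.59) p.86, (1.56) p.86, Prop. 3 p.87; Balaban1984PropagatorsII, Prop. 2.6 (2.136) p.247, (2.16) p.225, (2.19) p.226; Balaban1985BackgroundPropagators, Theorem 3.3 p.399, (3.47) p.398] -/
theorem ineq159_A_member_pref (d ℓ : ℕ) {σ : ℝ} (hσ : 0 < σ) :
    ∃ B₀ : ℝ, ∃ N₁ : ℕ, 1 ≤ B₀ ∧ 0 < N₁ ∧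
      ∀ (k Mh R : ℕ), 1 ≤ Mh → N₁ + 1 ≤ R * ((ℓ + 1) * Mh) →
      ∀ (P' : Fin (d + 1) → ℕ) (_hP : ∀ μ, 1 ≤ P' μ) (D : B6MultiLevelTorusOperatorL0.TDomains d ℓ Mh k P' R)
        (m K : ℕ) (hd : 1 ≤ d + 1) (hL : Odd (ℓ + 1) ∧ 1 < ℓ + 1)
        (hN : ∀ μ, N0 ℓ Mh k P' μ = (PV d ℓ m K hd hL).sitesPerDir 0) (hk : k ≤ m + K)
        (cf : ℝ) (hcf : cf ≠ 0) (w : BondIdx (domT hN D hk) → ℝ) (hw : ∀ i, 0 < w i)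
        (b₀ b₁ : ℝ), 0 ≤ b₀ → 0 ≤ b₁ → GlobalBand b₀ b₁ cf w →
        ∀ (C : ℝ), 0 ≤ C →
        HasMajorant (g := geomT D) (blkV1 hN D) (onFun (GE (domT hN D hk) hcf hw))
          (fun y y' => C * pref cf y * Real.exp (-(σ * (geomT D).dist y y'))) →
        ∀ (A J : BondSpace (PV d ℓ m K hd hL)) (B : BondIdxSpace (domT hN D hk)),
          dcsE cf (dcE cf A) = J → RE (domT hN D hk) cf (dsE cf A) = 0 → QE (domT hN D hk) A = B →
          ∀ (nJ β : ℝ), 0 ≤ nJ → 0 ≤ β →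
            (∀ b, |J b| ≤ nJ * (((geomT D).len (blkV1 hN D b) * |cf|⁻¹) ^ 3)⁻¹) →
            (∀ i, |B i| ≤ β * (((ℓ : ℝ) + 1) ^ (i.1.1 : ℕ) * |cf|⁻¹)⁻¹) →
            ∀ b : PBond (PV d ℓ m K hd hL) 0,
              |A b| ≤ B₀ * C * (1 + 2 * b₁) * (nJ + β) * ((geomT D).len (blkV1 hN D b) * |cf|⁻¹)⁻¹ := by
  obtain ⟨B₀, N₁, hB₀, hN₁, h⟩ := ineq159_A_member_printed_V1_eta d ℓ hσ
  refine ⟨B₀, N₁, hB₀, hN₁, ?_⟩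
  intro k Mh R hMh1 hRM1 P' hP D m K hd hL hN hk cf hcf w hw b₀ b₁ hb₀ hb₁ hwb C hC hG
  have hη : 0 < |cf|⁻¹ := inv_pos.2 (abs_pos.2 hcf)
  have hG' : HasMajorant (g := geomT D) (blkV1 hN D) (onFun (GE (domT hN D hk) hcf hw))
      (fun y y' => C * ((geomT D).len y * |cf|⁻¹) ^ 2 * Real.exp (-(σ * (geomT D).dist y y'))) :=
    hasMajorant_mono (g := geomT D) (blkV1 hN D) hG fun y y' => le_of_eq (by rw [pref_eq])
  exact h k Mh R hMh1 hRM1 P' hP D m K hd hL hN hk cf hcf w hw |cf|⁻¹ hη b₁ hb₁ (window_of_globalBand hN D hk hb₀ hcf hwb) C hC hG'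

/-- **THE ROUTE V SOCKET, PROPOSITION 3**: `prop3_multiLevelTorus_V1_eta` with `η := |c′|⁻¹`, slot 1 LITERALLY r03's conclusion shape
`HasMajorant (geomT D) (blkV1 hN D) (onFun (GE (domT hN D hk) hc′ hw)) (fun y y′ ↦ C · pref c′ y · e^{−σ d_T(y,y′)})` (any `C ≥ 0`, `σ > 0`), the
window = print's (2.16) band `GlobalBand b₀ b₁ c′ w` (`0 ≤ b₀`, `0 ≤ b₁`), slots 2/3 (the (2.136)₂,₄-shape majorants of `Dop ν ∘ onFun G(1)`,
`Lop ∘ onFun G(1)`, not begun on the B6 side) with prefactors `C(Lʲ)|c′|⁻¹`, `C`: conclusions (1.59) ⟹ (1.60) ⟹ (1.62) exactly as in §6 with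
`B₀′ = (B₀C + 1)(1 + 2b₁)`, `B₀ = B₀(d, ℓ, σ)` — «depend on d and L only», uniformly in the lattice spacing `|c′|⁻¹`.
[cite: Balaban1985RegularSpaces, Prop. 3 p.87, (1.59)–(1.62) pp.86–87, (1.55)–(1.58) p.86; Balaban1984PropagatorsII, Prop. 2.6 (2.136) p.247, (2.16) p.225, (2.19) p.226; Balaban1985BackgroundPropagators, Theorem 3.3 p.399, (3.47) p.398] -/
theorem prop3_multiLevelTorus_V1_pref (d ℓ : ℕ) {σ : ℝ} (hσ : 0 < σ) :
    ∃ B₀ : ℝ, ∃ N₁ : ℕ, 1 ≤ B₀ ∧ 0 < N₁ ∧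
      ∀ (k Mh R : ℕ), 1 ≤ Mh → N₁ + 1 ≤ R * ((ℓ + 1) * Mh) →
      ∀ (P' : Fin (d + 1) → ℕ) (_hP : ∀ μ, 1 ≤ P' μ) (D : B6MultiLevelTorusOperatorL0.TDomains d ℓ Mh k P' R)
        (m K : ℕ) (hd : 1 ≤ d + 1) (hL : Odd (ℓ + 1) ∧ 1 < ℓ + 1)
        (hN : ∀ μ, N0 ℓ Mh k P' μ = (PV d ℓ m K hd hL).sitesPerDir 0) (hk : k ≤ m + K)
        (cf : ℝ) (hcf : cf ≠ 0) (w : BondIdx (domT hN D hk) → ℝ) (hw : ∀ i, 0 < w i)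
        (b₀ b₁ : ℝ) (_hb₀ : 0 ≤ b₀) (_hb₁ : 0 ≤ b₁) (_hwb : GlobalBand b₀ b₁ cf w) (C : ℝ) (_hC : 0 ≤ C)
        (Dop : Fin (d + 1) → Module.End ℝ (PBond (PV d ℓ m K hd hL) 0 → ℝ))
        (Lop : Module.End ℝ (PBond (PV d ℓ m K hd hL) 0 → ℝ)),
        HasMajorant (g := geomT D) (blkV1 hN D) (onFun (GE (domT hN D hk) hcf hw))
          (fun y y' => C * pref cf y * Real.exp (-(σ * (geomT D).dist y y'))) →
        (∀ ν, HasMajorant (g := geomT D) (blkV1 hN D) (Dop ν ∘ₗ onFun (GE (domT hN D hk) hcf hw))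
          (fun y y' => C * ((geomT D).len y * |cf|⁻¹) * Real.exp (-(σ * (geomT D).dist y y')))) →
        HasMajorant (g := geomT D) (blkV1 hN D) (Lop ∘ₗ onFun (GE (domT hN D hk) hcf hw))
          (fun y y' => C * Real.exp (-(σ * (geomT D).dist y y'))) →
        ∀ (A J : BondSpace (PV d ℓ m K hd hL)) (B : BondIdxSpace (domT hN D hk)),
          dcsE cf (dcE cf A) = J → RE (domT hN D hk) cf (dsE cf A) = 0 → QE (domT hN D hk) A = B →
          ∀ (nJ nB : ℝ), 0 ≤ nJ → 0 ≤ nB →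
            (∀ b, |J b| ≤ nJ * (((geomT D).len (blkV1 hN D b) * |cf|⁻¹) ^ 3)⁻¹) →
            (∀ i, |B i| ≤ nB * (((ℓ : ℝ) + 1) ^ (i.1.1 : ℕ) * |cf|⁻¹)⁻¹) →
          ∀ (dP LP C₂ α₀ α₁ α₂ : ℝ), 0 ≤ dP → 1 ≤ dP * LP → 0 ≤ α₀ → 0 ≤ α₁ → 0 ≤ α₂ →
            nJ ≤ 2 * α₀ + 36 * dP * α₂ *
                msup (ℓ + 1) k |cf|⁻¹ (-2) (fun j (p : Fin (d + 1) × PBond (PV d ℓ m K hd hL) 0) => j ≤ (blkV1 hN D p.2).1.1)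
                  (fun p : Fin (d + 1) × PBond (PV d ℓ m K hd hL) 0 => Dop p.1 (WithLp.ofLp A) p.2) +
              50 * dP * α₂ ^ 3 + 10 * dP * α₀ * α₂ →
            nB ≤ 2 * dP * LP * α₁ + C₂ * α₂ ^ 2 →
            36 * dP * ((B₀ * C + 1) * (1 + 2 * b₁)) * α₂ ≤ 1 / 2 → 50 * dP * α₂ ≤ 1 →
            2 * α₂ ^ 2 + 20 * dP * α₀ * α₂ + 2 * C₂ * α₂ ^ 2 ≤ α₀ + α₁ →
            msup (ℓ + 1) k |cf|⁻¹ (-1) (fun j (b : PBond (PV d ℓ m K hd hL) 0) => j ≤ (blkV1 hN D b).1.1) (WithLp.ofLp A) ≤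
                5 * dP * LP * ((B₀ * C + 1) * (1 + 2 * b₁)) * (α₀ + α₁) ∧
              msup (ℓ + 1) k |cf|⁻¹ (-2) (fun j (p : Fin (d + 1) × PBond (PV d ℓ m K hd hL) 0) => j ≤ (blkV1 hN D p.2).1.1)
                  (fun p : Fin (d + 1) × PBond (PV d ℓ m K hd hL) 0 => Dop p.1 (WithLp.ofLp A) p.2) ≤
                5 * dP * LP * ((B₀ * C + 1) * (1 + 2 * b₁)) * (α₀ + α₁) ∧
              nJ ≤ 5 * dP * LP * ((B₀ * C + 1) * (1 + 2 * b₁)) * (α₀ + α₁) ∧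
              msup (ℓ + 1) k |cf|⁻¹ (-3) (fun j (b : PBond (PV d ℓ m K hd hL) 0) => j ≤ (blkV1 hN D b).1.1) (Lop (WithLp.ofLp A)) ≤
                5 * dP * LP * ((B₀ * C + 1) * (1 + 2 * b₁)) * (α₀ + α₁) ∧
              (∀ b : PBond (PV d ℓ m K hd hL) 0,
                |WithLp.ofLp A b| ≤ 5 * dP * LP * ((B₀ * C + 1) * (1 + 2 * b₁)) * (α₀ + α₁) *
                  (((geomT D).len (blkV1 hN D b) * |cf|⁻¹) ^ 1)⁻¹) ∧
              (∀ (ν : Fin (d + 1)) (b : PBond (PV d ℓ m K hd hL) 0),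
                |Dop ν (WithLp.ofLp A) b| ≤ 5 * dP * LP * ((B₀ * C + 1) * (1 + 2 * b₁)) * (α₀ + α₁) *
                  (((geomT D).len (blkV1 hN D b) * |cf|⁻¹) ^ 2)⁻¹) ∧
              (∀ b : PBond (PV d ℓ m K hd hL) 0,
                |Lop (WithLp.ofLp A) b| ≤ 5 * dP * LP * ((B₀ * C + 1) * (1 + 2 * b₁)) * (α₀ + α₁) *
                  (((geomT D).len (blkV1 hN D b) * |cf|⁻¹) ^ 3)⁻¹) := by
  obtain ⟨B₀, N₁, hB₀, hN₁, h⟩ := prop3_multiLevelTorus_V1_eta d ℓ hσ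
  refine ⟨B₀, N₁, hB₀, hN₁, ?_⟩
  intro k Mh R hMh1 hRM1 P' hP D m K hd hL hN hk cf hcf w hw b₀ b₁ hb₀ hb₁ hwb C hC Dop Lop hG
  have hη : 0 < |cf|⁻¹ := inv_pos.2 (abs_pos.2 hcf)
  have hG' : HasMajorant (g := geomT D) (blkV1 hN D) (onFun (GE (domT hN D hk) hcf hw))
      (fun y y' => C * ((geomT D).len y * |cf|⁻¹) ^ 2 * Real.exp (-(σ * (geomT D).dist y y'))) :=
    hasMajorant_mono (g := geomT D) (blkV1 hN D) hG fun y y' => le_of_eq (by rw [pref_eq])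
  exact h k Mh R hMh1 hRM1 P' hP D m K hd hL hN hk cf hcf w hw |cf|⁻¹ hη b₁ hb₁ (window_of_globalBand hN D hk hb₀ hcf hwb) C hC
    Dop Lop hG'

end Socket

end

end Literature.MathematicalPhysics.QuantumFieldTheory.Balaban1983to89.B8Prop3MultiLevelTorusEtaL0
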